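import Mathlib
import Literature.NumberTheory.LFunctions.BuiHall.Defs
import HarnessLib

/-!
# Bui–Hall sign conjecture, hub-kernel port — the analytic leg (box `BuiHallSign.lean`), part 1/3

LINE 1 — LABEL: RH-FREE (a theorem about explicit polynomial integrals — the sign of the main-term coefficient
`HARDY(k,ℓ,m,n)` of the mixed fourth moments of the derivatives of Hardy's `Z`); LADDER-RH materiality NIL
(director-rh 2026-08-27); class RECORDS → PAPERS. Nothing here bears on the truth of RH.

PROVENANCE (byte level). Hub-kernel PORT of the box file `run/shared/lean/archive/2001-boxes/rh/summits/rh-w-lgap/free/y2/lean/BuiHallSign.lean` (sha256/16 `560d5e447cc8ed51`),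
itself GENERATED by `run/shared/lean/archive/2001-boxes/rh/summits/rh-w-lgap/free/y2/lean/gen/gen_bh.py` (sha256/16 `80cee6d9d1ddbd5e`; `--assemble` from cells.json sha256
`03ab224ad42ef36c…` + certs.jsonl sha256 `240e612880cce7bc…`, run rh-lgapy2-bh-2, and the hand-written parts `gen/part_*.lean`).
This module = part 1 of 3 of the box file's body (sections: Section 3 of the paper: the residue computation behind the Bui–Hall rule; The objects of the paper (Sections 1–4); Lemma C (tex l.163–171) — part 1: `h_{c,d} = -F_{c,d}` on `[0,2]`, evenness, con; Lemma C — part 2: (a) `F` strictly increasing on `[0,1]` (hence `h_{c,d}` strict; Lemma C — part 3: `∫_0^2 h_{c,d} = 0` (the Fubini step "`∫_{-2}^{2} h_{c,d} = -∫; Lemma C — part 4: condition (i): `H_{c,d} ≥ 0` on `[0,2]`, `> 0` on `(0,2)`; Proposition oddodd — the analytic step ("the integral is negative"), proved: `Od; Lemma C (c), sharp form: `h_{c,d}` vanishes exactly once in `(0,2)`, at some `t₀; Corollary signs (a) — all orders even ⇒ `M(k) > 0`, proved: `AllEvenPos`; Section 4.1: `Λ_{c,d}` (eq. (Lcd)),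 the implication `Λ_{c,d} ≤ 0` ⇒ (spade) (PRO; The chart identity eq. (Tcd) — part 1: one-dimensional tools; The chart identity eq. (Tcd) — part 2: the `(u₃,u₄,u₁)`-chart on `∫_Q`, proved: ; Proposition `11family` (= Prop. 6) — part 1: the fold, `S̃⁰ ≥ 0` from (spade), `).  Port edits ONLY: namespace `Literature.NumberTheory.LFunctions.BuiHall` (+ a `Part…` sub-namespace for the generated
decision-tree names), the shared definitions block replaced by `import Literature.NumberTheory.LFunctions.BuiHall.Defs`, module split to the hub's file-size cap,
docstrings/provenance tags added; statements and proof scripts are verbatim unless a docstring says otherwise.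

CONTEXT (box paper = the 2001-box write-up `work/paper-v3-d979a68f.tex`, its Theorem 13 = the Bui–Hall sign conjecture
[BuiHall2023, §1 Conjecture 1]; fidelity notes `FIDELITY-BH.md` in the box): the paper's objects (HARDY = Bui–Hall's quadruple
integral verbatim, `M` via `∫_Q`, `h_{c,d}`, `H_{c,d}`, `F_{c,d}`, `T`), the residue rule of Section 3, Lemma C, Corollary signs (a),
Proposition oddodd's analytic step, the chart identity eq. (Tcd), Proposition 11family's implication, Section 4.1 (eq. (Lcd), the
mixture, Lemma QI, eq. (prims)) and Theorem structure are PROVED across the modules `Sign1…`; the master inequality `Λ ≤ 0` on `D`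
comes from the `Certs…`/`Master…` modules; everything is assembled in module `Final` (`theorem_BH_sign`, hypothesis-free).
Intermediate statements of the box paper are kept as named Props (`StructureThm`, `ChartIdentity`, …) exactly as in the box file and
each is PROVED in these modules (`structureThm_holds`, `chartIdentity_holds`, `allEvenPos_holds`, `oddOddCore_holds`,
`elevenCore_holds`, `lemmaC_conclusions`, `mixture_holds`, `reduction_of_mixture`); none is left as a hypothesis.
-/

set_option maxRecDepth 4000
set_option maxHeartbeats 2000000 -- generated certificate identities (`grind`) and long `linarith` calls
set_option linter.unusedVariables false -- generated cell signatures are uniform; a given certificate uses only some hypotheses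
set_option linter.unusedSimpArgs false -- the generated `simp only [...]` unfolding lists are uniform across cells
set_option linter.unusedTactic false -- idem (generated scripts)
set_option linter.unreachableTactic false -- idem (generated scripts)
set_option linter.style.longLine false -- generated one-line polynomial identities
set_option linter.style.longFile 0
set_option Elab.async false

noncomputable section

namespace Literature.NumberTheory.LFunctions.BuiHall

open _root_.MeasureTheory intervalIntegral _root_.Set _root_.Filter


/-! ## Section 3 of the paper: the residue computation behind the Bui–Hall rule

For `K = k₁+k₂+k₃+k₄` even, `|i^{k₁}+i^{k₂}+i^{k₃}+i^{k₄}| = 2` holds exactly when an odd number of the `k_j` are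
`≡ 2, 3 (mod 4)`, which is exactly when `K/2 + r` is odd, `2r` being the number of odd `k_j`
(paper, proof of Corollary `signs`: "the Bui–Hall rule reads `sgn HARDY = i^K (-1)^r`").  Everything depends only on the
residues `k_j mod 4`, so the two equivalences are finite checks (`decide` over `Fin 4 ^ 4`). -/

/-- real and imaginary part of `i^m` [folklore] -/
def giRe (m : ℕ) : ℤ := if m % 4 = 0 then 1 else if m % 4 = 2 then -1 else 0
/-- imaginary part of `i^m` (as an integer; companion of `giRe`) [folklore] -/
def giIm (m : ℕ) : ℤ := if m % 4 = 1 then 1 else if m % 4 = 3 then -1 else 0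

/-- number of odd entries (`= 2 r(k)` when `K` is even) and number of entries `≡ 2,3 (mod 4)` [folklore] -/
def nOdd (k₁ k₂ k₃ k₄ : ℕ) : ℕ := k₁ % 2 + k₂ % 2 + k₃ % 2 + k₄ % 2
/-- number of entries `k_j ≡ 2, 3 (mod 4)` among `k₁, k₂, k₃, k₄` [folklore] -/
def n23 (k₁ k₂ k₃ k₄ : ℕ) : ℕ :=
  (if 2 ≤ k₁ % 4 then 1 else 0) + (if 2 ≤ k₂ % 4 then 1 else 0) + (if 2 ≤ k₃ % 4 then 1 else 0)
    + (if 2 ≤ k₄ % 4 then 1 else 0)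
/-- squared modulus of `i^{k₁}+i^{k₂}+i^{k₃}+i^{k₄}` as an integer [folklore] -/
def sumNormSq (k₁ k₂ k₃ k₄ : ℕ) : ℤ :=
  (giRe k₁ + giRe k₂ + giRe k₃ + giRe k₄) ^ 2 + (giIm k₁ + giIm k₂ + giIm k₃ + giIm k₄) ^ 2

/-- Auxiliary lemma `I_pow_eq_gi` of the Bui–Hall sign-conjecture leg (Section 3 of the paper: the residue computation behind the Bui–Hall rule); statement as displayed, box port verbatim. [cite: BuiHall2023, §1 Conjecture 1 — a step of THIS TREE's proof of it (box write-up paper-v3-d979a68f Section 3 of the paper: the residue computation behind the Bui–Hall ru); the cited paper states the conjecture and the proof is ours] -/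
theorem I_pow_eq_gi (m : ℕ) : (Complex.I) ^ m = ⟨(giRe m : ℝ), (giIm m : ℝ)⟩ := by
  have h4 : Complex.I ^ 4 = 1 := by
    rw [show (4:ℕ) = 2 * 2 from rfl, pow_mul, Complex.I_sq]; norm_num
  conv_lhs => rw [← Nat.div_add_mod m 4, pow_add, pow_mul, h4, one_pow, one_mul]
  have hm : m % 4 < 4 := Nat.mod_lt _ (by norm_num)
  unfold giRe giIm
  interval_cases hr : m % 4
  · simp [Complex.ext_iff]
  · simp [Complex.ext_iff]
  · simp [Complex.ext_iff]
  · simp [pow_succ, Complex.ext_iff]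

/-- Auxiliary lemma `sum_I_pow_eq` of the Bui–Hall sign-conjecture leg (Section 3 of the paper: the residue computation behind the Bui–Hall rule); statement as displayed, box port verbatim. [cite: BuiHall2023, §1 Conjecture 1 — a step of THIS TREE's proof of it (box write-up paper-v3-d979a68f Section 3 of the paper: the residue computation behind the Bui–Hall ru); the cited paper states the conjecture and the proof is ours] -/
theorem sum_I_pow_eq (k₁ k₂ k₃ k₄ : ℕ) :
    Complex.I ^ k₁ + Complex.I ^ k₂ + Complex.I ^ k₃ + Complex.I ^ k₄
      = ⟨((giRe k₁ + giRe k₂ + giRe k₃ + giRe k₄ : ℤ) : ℝ), ((giIm k₁ + giIm k₂ + giIm k₃ + giIm k₄ : ℤ) : ℝ)⟩ := by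
  simp only [I_pow_eq_gi, Complex.ext_iff, Complex.add_re, Complex.add_im]
  push_cast
  exact ⟨rfl, rfl⟩

/-- `|i^{k₁}+i^{k₂}+i^{k₃}+i^{k₄}| = 2` iff the integer squared modulus is `4` [cite: BuiHall2023, §1 Conjecture 1 — a step of THIS TREE's proof of it (box write-up paper-v3-d979a68f Section 3 of the paper: the residue computation behind the Bui–Hall ru); the cited paper states the conjecture and the proof is ours] -/
theorem norm_sum_I_pow_eq_two_iff (k₁ k₂ k₃ k₄ : ℕ) :
    ‖Complex.I ^ k₁ + Complex.I ^ k₂ + Complex.I ^ k₃ + Complex.I ^ k₄‖ = 2 ↔ sumNormSq k₁ k₂ k₃ k₄ = 4 := by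
  rw [sum_I_pow_eq]
  set a : ℤ := giRe k₁ + giRe k₂ + giRe k₃ + giRe k₄ with ha
  set b : ℤ := giIm k₁ + giIm k₂ + giIm k₃ + giIm k₄ with hb
  have hn : ‖(⟨(a:ℝ), (b:ℝ)⟩ : ℂ)‖ = Real.sqrt ((a:ℝ)^2 + (b:ℝ)^2) := by
    rw [Complex.norm_eq_sqrt_sq_add_sq]
  rw [hn, show sumNormSq k₁ k₂ k₃ k₄ = a ^ 2 + b ^ 2 from rfl]
  constructor
  · intro h
    have h2 : (a:ℝ)^2 + (b:ℝ)^2 = 4 := by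
      have := Real.sq_sqrt (add_nonneg (sq_nonneg (a:ℝ)) (sq_nonneg (b:ℝ)))
      rw [h] at this; linarith
    exact_mod_cast h2
  · intro h
    have h2 : (a:ℝ)^2 + (b:ℝ)^2 = 4 := by exact_mod_cast h
    rw [h2, show (4:ℝ) = 2 ^ 2 by norm_num, Real.sqrt_sq (by norm_num)]

/-- the finite check on residues: for an even residue sum, `|Σ i^{k_j}|² = 4` iff an odd number of residues lie in
`{2,3}` iff `K/2 + r` is odd [folklore] -/
private theorem residue_table :
    ∀ a b c d : Fin 4, (a.val + b.val + c.val + d.val) % 2 = 0 →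
      ((sumNormSq a.val b.val c.val d.val = 4 ↔ n23 a.val b.val c.val d.val % 2 = 1) ∧
       (n23 a.val b.val c.val d.val % 2 = 1 ↔
          ((a.val + b.val + c.val + d.val) / 2 + nOdd a.val b.val c.val d.val / 2) % 2 = 1)) := by
  decide

/-- Auxiliary lemma `giRe_mod` of the Bui–Hall sign-conjecture leg (Section 3 of the paper: the residue computation behind the Bui–Hall rule); statement as displayed, box port verbatim. [cite: BuiHall2023, §1 Conjecture 1 — a step of THIS TREE's proof of it (box write-up paper-v3-d979a68f Section 3 of the paper: the residue computation behind the Bui–Hall ru); the cited paper states the conjecture and the proof is ours] -/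
theorem giRe_mod (m : ℕ) : giRe m = giRe (m % 4) := by simp [giRe]
/-- Auxiliary lemma `giIm_mod` of the Bui–Hall sign-conjecture leg (Section 3 of the paper: the residue computation behind the Bui–Hall rule); statement as displayed, box port verbatim. [cite: BuiHall2023, §1 Conjecture 1 — a step of THIS TREE's proof of it (box write-up paper-v3-d979a68f Section 3 of the paper: the residue computation behind the Bui–Hall ru); the cited paper states the conjecture and the proof is ours] -/
theorem giIm_mod (m : ℕ) : giIm m = giIm (m % 4) := by simp [giIm]

/-- **Residue rule** (paper Section 3): for `K` even, `|i^{k₁}+i^{k₂}+i^{k₃}+i^{k₄}| = 2` iff `K/2 + r(k)` is odd,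
where `2 r(k)` is the number of odd `k_j`; i.e. iff `i^K (-1)^{r} = -1`. [cite: BuiHall2023, §1 Conjecture 1 with Remark 1 (the condition |i^k+i^ℓ+i^m+i^n| = 2 — here as a finite check on residues mod 4)] -/
theorem bh_rule_iff_odd (k₁ k₂ k₃ k₄ : ℕ) (hK : Even (k₁ + k₂ + k₃ + k₄)) :
    ‖Complex.I ^ k₁ + Complex.I ^ k₂ + Complex.I ^ k₃ + Complex.I ^ k₄‖ = 2
      ↔ Odd ((k₁ + k₂ + k₃ + k₄) / 2 + nOdd k₁ k₂ k₃ k₄ / 2) := by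
  rw [norm_sum_I_pow_eq_two_iff]
  have h1 := Nat.mod_lt k₁ (show 0 < 4 by norm_num)
  have h2 := Nat.mod_lt k₂ (show 0 < 4 by norm_num)
  have h3 := Nat.mod_lt k₃ (show 0 < 4 by norm_num)
  have h4 := Nat.mod_lt k₄ (show 0 < 4 by norm_num)
  obtain ⟨q₁, e₁⟩ : ∃ q, k₁ = 4 * q + k₁ % 4 := ⟨k₁ / 4, (Nat.div_add_mod k₁ 4).symm⟩
  obtain ⟨q₂, e₂⟩ : ∃ q, k₂ = 4 * q + k₂ % 4 := ⟨k₂ / 4, (Nat.div_add_mod k₂ 4).symm⟩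
  obtain ⟨q₃, e₃⟩ : ∃ q, k₃ = 4 * q + k₃ % 4 := ⟨k₃ / 4, (Nat.div_add_mod k₃ 4).symm⟩
  obtain ⟨q₄, e₄⟩ : ∃ q, k₄ = 4 * q + k₄ % 4 := ⟨k₄ / 4, (Nat.div_add_mod k₄ 4).symm⟩
  have T := residue_table ⟨k₁ % 4, h1⟩ ⟨k₂ % 4, h2⟩ ⟨k₃ % 4, h3⟩ ⟨k₄ % 4, h4⟩
  simp only [] at T
  -- residue sum is even
  have hpar : (k₁ % 4 + k₂ % 4 + k₃ % 4 + k₄ % 4) % 2 = 0 := by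
    obtain ⟨t, ht⟩ := hK; omega
  obtain ⟨T1, T2⟩ := T hpar
  have hS : sumNormSq k₁ k₂ k₃ k₄ = sumNormSq (k₁ % 4) (k₂ % 4) (k₃ % 4) (k₄ % 4) := by
    simp only [sumNormSq]; rw [giRe_mod k₁, giRe_mod k₂, giRe_mod k₃, giRe_mod k₄, giIm_mod k₁, giIm_mod k₂,
      giIm_mod k₃, giIm_mod k₄]
  have hN : n23 k₁ k₂ k₃ k₄ = n23 (k₁ % 4) (k₂ % 4) (k₃ % 4) (k₄ % 4) := by
    simp only [n23, Nat.mod_mod]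
  have hO : nOdd k₁ k₂ k₃ k₄ = nOdd (k₁ % 4) (k₂ % 4) (k₃ % 4) (k₄ % 4) := by
    simp only [nOdd]; omega
  rw [hS, T1, T2, Nat.odd_iff]
  -- K/2 and (residue sum)/2 have the same parity, since K = 4(q₁+q₂+q₃+q₄) + residue sum
  have : (k₁ + k₂ + k₃ + k₄) / 2 = 2 * (q₁ + q₂ + q₃ + q₄) + (k₁ % 4 + k₂ % 4 + k₃ % 4 + k₄ % 4) / 2 := by omega
  rw [this, hO]; constructor <;> intro h <;> omega


/-! ## The objects of the paper (Sections 1–4) -/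


/-- The four-fold integral of eq. (BHint) (tex 37–40) times `3`, without the unimodular prefactor
`(-1)^{m+n} i^{k+ℓ+m+n}`; iterated interval integrals over `[0,1]` (byte-identical to the v1 leg `LgapY2.bhInt`). [cite: BuiHall2023, §1 Thm. 3 (arXiv:2304.05178 numbering): the quadruple integral over the unit 4-cube in the formula for HARDY] -/
noncomputable def bhInt (k l m n : ℕ) : ℝ :=
  3 * ∫ u1 in (0:ℝ)..1, ∫ u2 in (0:ℝ)..1, ∫ u3 in (0:ℝ)..1, ∫ u4 in (0:ℝ)..1,
    (u1 - u2) ^ 2 * (1 / 2 + (u1 - u2) * u3 - u1) ^ k * (1 / 2 + (u2 - u1) * u3 - u2) ^ l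
      * (1 / 2 + (u1 - u2) * u4 - u1) ^ m * (1 / 2 + (u2 - u1) * u4 - u2) ^ n

/-- `HARDY(k,ℓ,m,n)` exactly as eq. (BHint): `(-1)^(m+n) · i^(k+ℓ+m+n) · 3 ∫_{[0,1]^4} (…)`. [cite: BuiHall2023, §1 Thm. 3 (arXiv:2304.05178 numbering): HARDY = (−1)^(m+n) i^(k+ℓ+m+n) · 3 · ∫ over the unit 4-cube of (u₁−u₂)²(½+(u₁−u₂)u₃−u₁)^k (½+(u₂−u₁)u₃−u₂)^ℓ (½+(u₁−u₂)u₄−u₁)^m (½+(u₂−u₁)u₄−u₂)^n] -/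
noncomputable def HARDY (k l m n : ℕ) : ℂ :=
  (-1) ^ (m + n) * Complex.I ^ (k + l + m + n) * (bhInt k l m n : ℂ)

/-- `∫_Q g dη := ∫_{[-1,1]^3} g(η₁,η₂,η₃,-η₁-η₂-η₃) 1[|η₁+η₂+η₃| ≤ 1] dη` (Step 3 of the proof of Theorem structure). [folklore] -/
noncomputable def intQ (g : ℝ → ℝ → ℝ → ℝ → ℝ) : ℝ :=
  ∫ a in (-1:ℝ)..1, ∫ b in (-1:ℝ)..1, ∫ c in (-1:ℝ)..1,
    (if |a + b + c| ≤ 1 then g a b c (-a - b - c) else 0)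

/-- `M(k) := E[U₁^{k₁}U₂^{k₂}U₃^{k₃}U₄^{k₄} | S = 0] = (3/16) ∫_Q η^k dη`, the conditional moment of eq. (structureU),
written through Step 3's normalisation `E[g(U) | S=0] = (3/16) ∫_Q g` (so that no conditional expectation is needed). [folklore] -/
noncomputable def M (k₁ k₂ k₃ k₄ : ℕ) : ℝ :=
  3 / 16 * intQ (fun a b c d => a ^ k₁ * b ^ k₂ * c ^ k₃ * d ^ k₄)

/-- **Theorem `structure`** of the paper (eq. (structureU) and "`HARDY` is a symmetric function of its four arguments"),
kept as a named Prop and PROVED below (v3: `structureThm_holds`, section `struct*` — Steps 1–3 of the paper's proof: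
oriented line integrals, the linear chart to the hyperplane Σξ = 0 with fibre length ½ − ‖ξ‖_∞, layer cake, scaling). [cite: BuiHall2023, §1 Conj. 1 (the Bui–Hall sign law) is the statement PROVED through this intermediate Prop of the present tree (box write-up paper-v3-d979a68f Thm. 1 (structure)) — NOT a statement of the cited paper; discharged in these modules by the theorem of the same name with suffix _holds and never assumed] -/
def StructureThm : Prop :=
  (∀ k₁ k₂ k₃ k₄ : ℕ, HARDY k₁ k₂ k₃ k₄ =
      Complex.I ^ (k₁ + k₂ + k₃ + k₄) / ((2:ℂ) ^ (((k₁ + k₂ + k₃ + k₄ : ℕ) : ℤ) - 1) * ((k₁ + k₂ + k₃ + k₄ : ℕ) + 4))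
        * (M k₁ k₂ k₃ k₄ : ℂ)) ∧
  (∀ k₁ k₂ k₃ k₄ : ℕ, HARDY k₁ k₂ k₃ k₄ = HARDY k₂ k₁ k₃ k₄ ∧ HARDY k₁ k₂ k₃ k₄ = HARDY k₁ k₃ k₂ k₄ ∧
      HARDY k₁ k₂ k₃ k₄ = HARDY k₁ k₂ k₄ k₃)

/-- `h_{c,d}(t) := -∫_{-ℓ}^{ℓ} (t/2 + x)^{2c+1} (t/2 - x)^{2d+1} dx`, `ℓ = 1 - |t|/2` (Proposition `11family` = Prop. 6), for `|t| ≤ 2`. [folklore] -/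
noncomputable def hcd (c d : ℕ) (t : ℝ) : ℝ :=
  - ∫ x in (-(1 - |t| / 2))..(1 - |t| / 2), (t / 2 + x) ^ (2 * c + 1) * (t / 2 - x) ^ (2 * d + 1)

/-- `H_{c,d}(x) := ∫_0^x h_{c,d}` (Proposition `11family` = Prop. 6). [folklore] -/
noncomputable def Hcd (c d : ℕ) (x : ℝ) : ℝ := ∫ t in (0:ℝ)..x, hcd c d t

/-- `F_{c,d}(t) = ∫_{t-1}^{1} u^{2c+1} (t-u)^{2d+1} du`, the formula of Lemma C for `f_c * f_d` on `0 ≤ t ≤ 2`. [folklore] -/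
noncomputable def Fcd (c d : ℕ) (t : ℝ) : ℝ :=
  ∫ u in (t - 1)..1, u ^ (2 * c + 1) * (t - u) ^ (2 * d + 1)

/-- `T_{c,d}`-type double integral `∫_{[-1,1]^2} u^{k₃} v^{k₄} h_{c,d}(u+v) du dv` (eq. (Tcd) has `(k₃,k₄) = (2a,2b)`;
the first display of the proof of Proposition oddodd has `(2a+1,2b+1)`). [folklore] -/
noncomputable def Tint (c d k₃ k₄ : ℕ) : ℝ :=
  ∫ u in (-1:ℝ)..1, ∫ v in (-1:ℝ)..1, u ^ k₃ * v ^ k₄ * hcd c d (u + v)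

/-- **The chart identity** (eq. (Tcd) and its odd analogue: the `(u₃,u₄,u₁)`-chart computation opening the proofs of
Propositions 11family and oddodd), a three-dimensional Fubini/substitution — kept as a named Prop and PROVED below
(`chartIdentity_holds`, sections chart1–chart2). [cite: BuiHall2023, §1 Conj. 1 (the Bui–Hall sign law) is the statement PROVED through this intermediate Prop of the present tree (box write-up paper-v3-d979a68f eq. (Tcd)) — NOT a statement of the cited paper; discharged in these modules by the theorem of the same name with suffix _holds and never assumed] -/
def ChartIdentity : Prop :=
  (∀ c d a b : ℕ, M (2 * c + 1) (2 * d + 1) (2 * a) (2 * b) = -(3 / 16) * Tint c d (2 * a) (2 * b)) ∧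
  (∀ c d a b : ℕ, M (2 * c + 1) (2 * d + 1) (2 * a + 1) (2 * b + 1) = -(3 / 16) * Tint c d (2 * a + 1) (2 * b + 1))

/-- Corollary signs (a): all orders even ⇒ `M(k) > 0` ("the average over `Q` of a non-negative polynomial that is positive
off a null set"). [cite: BuiHall2023, §1 Conj. 1 (the Bui–Hall sign law) is the statement PROVED through this intermediate Prop of the present tree (box write-up paper-v3-d979a68f Cor. 2 (a)) — NOT a statement of the cited paper; discharged in these modules by the theorem of the same name with suffix _holds and never assumed] -/
def AllEvenPos : Prop := ∀ a b c d : ℕ, 0 < M (2 * a) (2 * b) (2 * c) (2 * d)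

/-- condition (C) of Proposition oddodd for `h_{c,d}` [cite: BuiHall2023, §1 Conj. 1 (the Bui–Hall sign law) is the statement PROVED through this intermediate Prop of the present tree (box write-up paper-v3-d979a68f Prop. 8 condition (C)) — NOT a statement of the cited paper; discharged in these modules by the theorem of the same name with suffix _holds and never assumed] -/
def CondC (c d : ℕ) : Prop :=
  StrictAntiOn (hcd c d) (Icc 0 1) ∧ ∀ s ∈ Icc (0:ℝ) 1, hcd c d (1 + s) ≤ hcd c d (1 - s)

/-- condition (i) of Proposition `11family` (= Prop. 6): `H_{c,d} ≥ 0` on `[0,2]`, `> 0` on `(0,2)` [cite: BuiHall2023, §1 Conj. 1 (the Bui–Hall sign law) is the statement PROVED through this intermediate Prop of the present tree (box write-up paper-v3-d979a68f Prop. 6 condition (i)) — NOT a statement of the cited paper; discharged in these modules by the theorem of the same name with suffix _holds and never assumed] -/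
def CondI (c d : ℕ) : Prop :=
  (∀ t ∈ Icc (0:ℝ) 2, 0 ≤ Hcd c d t) ∧ (∀ t ∈ Ioo (0:ℝ) 2, 0 < Hcd c d t)

/-- the pointwise inequality (spade) for the pair `(c,d)` [cite: BuiHall2023, §1 Conj. 1 (the Bui–Hall sign law) is the statement PROVED through this intermediate Prop of the present tree (box write-up paper-v3-d979a68f inequality (spade)) — NOT a statement of the cited paper; discharged in these modules by the theorem of the same name with suffix _holds and never assumed] -/
def Spade (c d : ℕ) : Prop :=
  ∀ u v : ℝ, 0 ≤ v → v ≤ u → u ≤ 1 → Hcd c d (u + v) - Hcd c d (u - v) ≤ Hcd c d (1 - u) + Hcd c d (1 + u)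

/-- the analytic step of Proposition oddodd: under (C) the double integral is negative
("so the integral is negative and the conditional moment positive") [cite: BuiHall2023, §1 Conj. 1 (the Bui–Hall sign law) is the statement PROVED through this intermediate Prop of the present tree (box write-up paper-v3-d979a68f Prop. 8; analytic step) — NOT a statement of the cited paper; discharged in these modules by the theorem of the same name with suffix _holds and never assumed] -/
def OddOddCore : Prop := ∀ c d : ℕ, CondC c d → ∀ a b : ℕ, Tint c d (2 * a + 1) (2 * b + 1) < 0

/-- Proposition `11family` (= Prop. 6) with (ii⁰) supplied by (spade): (i) ∧ (spade) ⇒ `T_{c,d}(a,b) > 0` for all `a,b` — kept as a named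
Prop and PROVED below (`elevenCore_holds`, sections eleven1–eleven2: the fold, `S̃⁰ ≥ 0` from (spade), and eq. (byparts) in
mixture/Fubini form). [cite: BuiHall2023, §1 Conj. 1 (the Bui–Hall sign law) is the statement PROVED through this intermediate Prop of the present tree (box write-up paper-v3-d979a68f Prop. 6) — NOT a statement of the cited paper; discharged in these modules by the theorem of the same name with suffix _holds and never assumed] -/
def ElevenCore : Prop := ∀ c d : ℕ, CondI c d → Spade c d → ∀ a b : ℕ, 0 < Tint c d (2 * a) (2 * b)

/-- Lemma C's conclusions used downstream: (C) [Lemma C (a),(b)] and (i) [Lemma C (c)] for every pair `(c,d)`. [cite: BuiHall2023, §1 Conj. 1 (the Bui–Hall sign law) is the statement PROVED through this intermediate Prop of the present tree (box write-up paper-v3-d979a68f Lemma 7) — NOT a statement of the cited paper; discharged in these modules by the theorem of the same name with suffix _holds and never assumed] -/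
def LemmaCConclusions : Prop := ∀ c d : ℕ, CondC c d ∧ CondI c d

/-- **Theorem master**: `Λ ≤ 0` on `D` (PROVED: `master_ineq` here from the seams `MasterTT/TF/F`, each proved in its sibling file as `master*_holds` from the 249 certificates). [cite: BuiHall2023, §1 Conj. 1 (the Bui–Hall sign law) is the statement PROVED through this intermediate Prop of the present tree (box write-up paper-v3-d979a68f Thm. 12 (master inequality)) — NOT a statement of the cited paper; discharged in these modules by the theorem of the same name with suffix _holds and never assumed] -/
def MasterIneq : Prop := ∀ u v x y : ℝ, (0 ≤ v ∧ v ≤ u ∧ u ≤ 1 ∧ 0 ≤ x ∧ x ≤ 1 ∧ 0 ≤ y ∧ y ≤ 1) → Lam u v x y ≤ 0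

/-- **Section 4.1's reduction** (Proposition reduce, first clause: eq. (Lcd), the mixture representation
`Λ_{c,d} = ∬ Λ(u,v;r,r') dm_c dm_d`, Lemma QI and eq. (prims)): `Λ ≤ 0` on `D` implies (spade) for every pair.
Kept as a named Prop; PROVED below as `reduction_of_mixture mixture_holds` (sections reduction, prims, qi1–qi2, mix1–mix2). [cite: BuiHall2023, §1 Conj. 1 (the Bui–Hall sign law) is the statement PROVED through this intermediate Prop of the present tree (box write-up paper-v3-d979a68f Prop. 11 (reduction)) — NOT a statement of the cited paper; discharged in these modules by the theorem of the same name with suffix _holds and never assumed] -/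
def Reduction : Prop := MasterIneq → ∀ c d : ℕ, Spade c d


/-! ## Lemma C (tex l.163–171) — part 1: `h_{c,d} = -F_{c,d}` on `[0,2]`, evenness, continuity, endpoint signs -/

section lemmaC
variable (c d : ℕ)

/-- the polynomial integrand `u^{2c+1} (t-u)^{2d+1}` of `F_{c,d}` [folklore] -/
noncomputable def gF (t u : ℝ) : ℝ := u ^ (2 * c + 1) * (t - u) ^ (2 * d + 1)

/-- Auxiliary lemma `gF_continuous` of the Bui–Hall sign-conjecture leg (Lemma C (tex l.163–171) — part 1: `h_{c,d} = -F_{c,d}` on `[0,2]`, evenness, continuity, endpoint signs); statement as displayed, box port verbatim. [cite: BuiHall2023, §1 Conjecture 1 — a step of THIS TREE's proof of it (box write-up paper-v3-d979a68f Lemma C (tex l.163–171) — part 1: `h_{cd} = -F_{cd}` on `[0;2]`; eve); the cited paper states the conjecture and the proof is ours] -/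
theorem gF_continuous : Continuous (Function.uncurry (gF c d)) := by
  unfold gF Function.uncurry; fun_prop

/-- Auxiliary lemma `Fcd_eq` of the Bui–Hall sign-conjecture leg (Lemma C (tex l.163–171) — part 1: `h_{c,d} = -F_{c,d}` on `[0,2]`, evenness, continuity, endpoint signs); statement as displayed, box port verbatim. [cite: BuiHall2023, §1 Conjecture 1 — a step of THIS TREE's proof of it (box write-up paper-v3-d979a68f Lemma C (tex l.163–171) — part 1: `h_{cd} = -F_{cd}` on `[0;2]`; eve); the cited paper states the conjecture and the proof is ours] -/
theorem Fcd_eq (t : ℝ) : Fcd c d t = ∫ u in (t - 1)..1, gF c d t u := rfl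

/-- Auxiliary lemma `Fcd_continuous` of the Bui–Hall sign-conjecture leg (Lemma C (tex l.163–171) — part 1: `h_{c,d} = -F_{c,d}` on `[0,2]`, evenness, continuity, endpoint signs); statement as displayed, box port verbatim. [cite: BuiHall2023, §1 Conjecture 1 — a step of THIS TREE's proof of it (box write-up paper-v3-d979a68f Lemma C (tex l.163–171) — part 1: `h_{cd} = -F_{cd}` on `[0;2]`; eve); the cited paper states the conjecture and the proof is ours] -/
theorem Fcd_continuous : Continuous (Fcd c d) := by
  have h := intervalIntegral.continuous_parametric_intervalIntegral_of_continuous (μ := volume) (a₀ := (1:ℝ))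
    (gF_continuous c d) (s := fun t : ℝ => t - 1) (by fun_prop)
  have e : Fcd c d = fun t => -∫ u in (1:ℝ)..(t - 1), gF c d t u := by
    ext t; rw [Fcd_eq, intervalIntegral.integral_symm]
  rw [e]; exact h.neg

/-- Auxiliary lemma `gF_intervalIntegrable` of the Bui–Hall sign-conjecture leg (Lemma C (tex l.163–171) — part 1: `h_{c,d} = -F_{c,d}` on `[0,2]`, evenness, continuity, endpoint signs); statement as displayed, box port verbatim. [cite: BuiHall2023, §1 Conjecture 1 — a step of THIS TREE's proof of it (box write-up paper-v3-d979a68f Lemma C (tex l.163–171) — part 1: `h_{cd} = -F_{cd}` on `[0;2]`; eve); the cited paper states the conjecture and the proof is ours] -/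
theorem gF_intervalIntegrable (t a b : ℝ) : IntervalIntegrable (gF c d t) volume a b :=
  ((gF_continuous c d).comp (Continuous.prodMk_right t)).intervalIntegrable a b

/-- `h_{c,d} = -F_{c,d}` on `[0,2]` (Lemma C: the substitution `u₁ = t/2 + x`) [cite: BuiHall2023, §1 Conjecture 1 — a step of THIS TREE's proof of it (box write-up paper-v3-d979a68f Lemma C (tex l.163–171) — part 1: `h_{cd} = -F_{cd}` on `[0;2]`; eve); the cited paper states the conjecture and the proof is ours] -/
theorem hcd_eq_neg_Fcd {t : ℝ} (ht0 : 0 ≤ t) (ht2 : t ≤ 2) : hcd c d t = -Fcd c d t := by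
  unfold hcd
  rw [abs_of_nonneg ht0, Fcd_eq]
  have key : ∫ x in (-(1 - t / 2))..(1 - t / 2), (t / 2 + x) ^ (2 * c + 1) * (t / 2 - x) ^ (2 * d + 1)
      = ∫ x in (-(1 - t / 2))..(1 - t / 2), gF c d t (t / 2 + x) := by
    apply intervalIntegral.integral_congr
    intro x _
    simp only [gF]
    congr 1
    ring
  rw [key, intervalIntegral.integral_comp_add_left (fun u => gF c d t u) (t / 2)]
  rw [show t / 2 + -(1 - t / 2) = t - 1 by ring, show t / 2 + (1 - t / 2) = 1 by ring]

/-- `h_{c,d}` is even [cite: BuiHall2023, §1 Conjecture 1 — a step of THIS TREE's proof of it (box write-up paper-v3-d979a68f Lemma C (tex l.163–171) — part 1: `h_{cd} = -F_{cd}` on `[0;2]`; eve); the cited paper states the conjecture and the proof is ours] -/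
theorem hcd_even (t : ℝ) : hcd c d (-t) = hcd c d t := by
  unfold hcd
  rw [abs_neg]
  congr 1
  have key : ∀ x : ℝ, (-t / 2 + x) ^ (2 * c + 1) * (-t / 2 - x) ^ (2 * d + 1)
      = (fun y => (t / 2 + y) ^ (2 * c + 1) * (t / 2 - y) ^ (2 * d + 1)) (-x) := by
    intro x
    have h1 : (-t / 2 + x) = -(t / 2 + -x) := by ring
    have h2 : (-t / 2 - x) = -(t / 2 - -x) := by ring
    simp only [h1, h2, Odd.neg_pow ⟨c, rfl⟩, Odd.neg_pow ⟨d, rfl⟩]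
    ring
  simp_rw [key]
  rw [intervalIntegral.integral_comp_neg (fun y => (t / 2 + y) ^ (2 * c + 1) * (t / 2 - y) ^ (2 * d + 1))]
  simp

/-- Lemma C (c), first clause: `F(0) < 0` [cite: BuiHall2023, §1 Conjecture 1 — a step of THIS TREE's proof of it (box write-up paper-v3-d979a68f Lemma C (tex l.163–171) — part 1: `h_{cd} = -F_{cd}` on `[0;2]`; eve); the cited paper states the conjecture and the proof is ours] -/
theorem Fcd_zero_neg : Fcd c d 0 < 0 := by
  rw [Fcd_eq]
  have key : ∀ u : ℝ, gF c d 0 u = -(u ^ (2 * c + 2 * d + 2)) := by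
    intro u; simp only [gF, zero_sub, Odd.neg_pow ⟨d, rfl⟩]; ring
  simp_rw [key, intervalIntegral.integral_neg, integral_pow]
  norm_num
  rw [show 2 * c + 2 * d + 2 + 1 = 2 * (c + d + 1) + 1 by ring, Odd.neg_pow ⟨c + d + 1, rfl⟩]
  have : (0:ℝ) < 2 * (c + d + 1 : ℕ) + 1 + 0 + 1 := by positivity
  apply div_pos _ (by positivity)
  norm_num

/-- Lemma C (c), second clause: `F > 0` on `[1,2)` [cite: BuiHall2023, §1 Conjecture 1 — a step of THIS TREE's proof of it (box write-up paper-v3-d979a68f Lemma C (tex l.163–171) — part 1: `h_{cd} = -F_{cd}` on `[0;2]`; eve); the cited paper states the conjecture and the proof is ours] -/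
theorem Fcd_pos_of_mem {t : ℝ} (ht1 : 1 ≤ t) (ht2 : t < 2) : 0 < Fcd c d t := by
  rw [Fcd_eq]
  apply intervalIntegral.intervalIntegral_pos_of_pos_on (gF_intervalIntegrable c d t _ _) _ (by linarith)
  intro u hu
  simp only [gF]
  have hu0 : 0 < u := by linarith [hu.1]
  have htu : 0 < t - u := by linarith [hu.2]
  positivity

/-- Lemma C (c), third clause: `F(2) = 0` [cite: BuiHall2023, §1 Conjecture 1 — a step of THIS TREE's proof of it (box write-up paper-v3-d979a68f Lemma C (tex l.163–171) — part 1: `h_{cd} = -F_{cd}` on `[0;2]`; eve); the cited paper states the conjecture and the proof is ours] -/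
theorem Fcd_two : Fcd c d 2 = 0 := by
  rw [Fcd_eq, show (2:ℝ) - 1 = 1 by norm_num, intervalIntegral.integral_same]

end lemmaC


/-! ## Lemma C — part 2: (a) `F` strictly increasing on `[0,1]` (hence `h_{c,d}` strictly decreasing), (b) -/

section lemmaC2
variable (c d : ℕ)

/-- Auxiliary lemma `odd_two_mul_add_one` of the Bui–Hall sign-conjecture leg (Lemma C — part 2: (a) `F` strictly increasing on `[0,1]` (hence `h_{c,d}` strictly decreasing), (b)); statement as displayed, box port verbatim. [cite: BuiHall2023, §1 Conjecture 1 — a step of THIS TREE's proof of it (box write-up paper-v3-d979a68f Lemma C — part 2: (a) `F` strictly increasing on `[0;1]` (hence `h_{c;); the cited paper states the conjecture and the proof is ours] -/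
theorem odd_two_mul_add_one (n : ℕ) : Odd (2 * n + 1) := ⟨n, rfl⟩

/-- the three pieces of `F(t) = ∫_{t-1}^0 + ∫_0^t + ∫_t^1` after substitution:
`A(t) = ∫_0^t u^{2c+1}(t-u)^{2d+1}`, `P(t) = ∫_t^1 u^{2c+1}(u-t)^{2d+1}`, `R(t) = ∫_t^1 (z-t)^{2c+1} z^{2d+1}` [folklore] -/
noncomputable def pieceA (t : ℝ) : ℝ := ∫ u in (0:ℝ)..t, gF c d t u
/-- `∫_t^1 u^{2c+1}(u−t)^{2d+1} du`, second piece of the split of `F_{c,d}` (Lemma C (a)) [folklore] -/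
noncomputable def pieceP (t : ℝ) : ℝ := ∫ u in t..1, u ^ (2 * c + 1) * (u - t) ^ (2 * d + 1)
/-- `∫_t^1 (z−t)^{2c+1} z^{2d+1} dz`, third piece of the split of `F_{c,d}` (Lemma C (a)) [folklore] -/
noncomputable def pieceR (t : ℝ) : ℝ := ∫ z in t..1, (z - t) ^ (2 * c + 1) * z ^ (2 * d + 1)

/-- Auxiliary lemma `Fcd_split` of the Bui–Hall sign-conjecture leg (Lemma C — part 2: (a) `F` strictly increasing on `[0,1]` (hence `h_{c,d}` strictly decreasing), (b)); statement as displayed, box port verbatim. [cite: BuiHall2023, §1 Conjecture 1 — a step of THIS TREE's proof of it (box write-up paper-v3-d979a68f Lemma C — part 2: (a) `F` strictly increasing on `[0;1]` (hence `h_{c;); the cited paper states the conjecture and the proof is ours] -/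
theorem Fcd_split (t : ℝ) : Fcd c d t = pieceA c d t - pieceP c d t - pieceR c d t := by
  rw [Fcd_eq]
  have hII := gF_intervalIntegrable c d t
  rw [← intervalIntegral.integral_add_adjacent_intervals (hII (t - 1) 0) (hII 0 1),
    ← intervalIntegral.integral_add_adjacent_intervals (hII 0 t) (hII t 1)]
  -- ∫_{t-1}^0 gF = -R
  have hC : ∫ u in (t - 1)..0, gF c d t u = -pieceR c d t := by
    have e : ∀ u : ℝ, gF c d t u = (fun z => (t - z) ^ (2 * c + 1) * z ^ (2 * d + 1)) (t - u) := by
      intro u; simp only [gF, sub_sub_cancel]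
    simp_rw [e]
    rw [intervalIntegral.integral_comp_sub_left (fun z => (t - z) ^ (2 * c + 1) * z ^ (2 * d + 1)) t]
    rw [show t - (t - 1) = 1 by ring, sub_zero, pieceR, ← intervalIntegral.integral_neg]
    apply intervalIntegral.integral_congr; intro z _
    simp only
    rw [show t - z = -(z - t) by ring, Odd.neg_pow (odd_two_mul_add_one c)]; ring
  -- ∫_t^1 gF = -P
  have hB : ∫ u in t..1, gF c d t u = -pieceP c d t := by
    rw [pieceP, ← intervalIntegral.integral_neg]
    apply intervalIntegral.integral_congr; intro u _
    simp only [gF]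
    rw [show t - u = -(u - t) by ring, Odd.neg_pow (odd_two_mul_add_one d)]; ring
  rw [hC, hB, pieceA]; ring

/-- Auxiliary lemma `pieceA_lt` of the Bui–Hall sign-conjecture leg (Lemma C — part 2: (a) `F` strictly increasing on `[0,1]` (hence `h_{c,d}` strictly decreasing), (b)); statement as displayed, box port verbatim. [cite: BuiHall2023, §1 Conjecture 1 — a step of THIS TREE's proof of it (box write-up paper-v3-d979a68f Lemma C — part 2: (a) `F` strictly increasing on `[0;1]` (hence `h_{c;); the cited paper states the conjecture and the proof is ours] -/
theorem pieceA_lt {t₁ t₂ : ℝ} (h0 : 0 ≤ t₁) (h12 : t₁ < t₂) : pieceA c d t₁ < pieceA c d t₂ := by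
  unfold pieceA
  have hII := gF_intervalIntegrable c d
  rw [← intervalIntegral.integral_add_adjacent_intervals (hII t₂ 0 t₁) (hII t₂ t₁ t₂)]
  have h1 : ∫ u in (0:ℝ)..t₁, gF c d t₁ u ≤ ∫ u in (0:ℝ)..t₁, gF c d t₂ u := by
    apply intervalIntegral.integral_mono_on h0 (hII t₁ 0 t₁) (hII t₂ 0 t₁)
    intro u hu
    simp only [gF]
    apply mul_le_mul_of_nonneg_left _ (pow_nonneg hu.1 _)
    exact (Odd.pow_le_pow (odd_two_mul_add_one d)).mpr (by linarith)
  have h2 : 0 < ∫ u in t₁..t₂, gF c d t₂ u := by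
    apply intervalIntegral.intervalIntegral_pos_of_pos_on (hII t₂ t₁ t₂) _ h12
    intro u hu
    simp only [gF]
    have : 0 < u := by linarith [hu.1]
    have : 0 < t₂ - u := by linarith [hu.2]
    positivity
  linarith

/-- Auxiliary lemma `pieceP_antitone` of the Bui–Hall sign-conjecture leg (Lemma C — part 2: (a) `F` strictly increasing on `[0,1]` (hence `h_{c,d}` strictly decreasing), (b)); statement as displayed, box port verbatim. [cite: BuiHall2023, §1 Conjecture 1 — a step of THIS TREE's proof of it (box write-up paper-v3-d979a68f Lemma C — part 2: (a) `F` strictly increasing on `[0;1]` (hence `h_{c;); the cited paper states the conjecture and the proof is ours] -/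
theorem pieceP_antitone {t₁ t₂ : ℝ} (h0 : 0 ≤ t₁) (h12 : t₁ ≤ t₂) (h2 : t₂ ≤ 1) :
    pieceP c d t₂ ≤ pieceP c d t₁ := by
  unfold pieceP
  have hc : ∀ s : ℝ, Continuous fun u : ℝ => u ^ (2 * c + 1) * (u - s) ^ (2 * d + 1) := by
    intro s; fun_prop
  rw [← intervalIntegral.integral_add_adjacent_intervals ((hc t₁).intervalIntegrable t₁ t₂)
    ((hc t₁).intervalIntegrable t₂ 1)]
  have h1 : 0 ≤ ∫ u in t₁..t₂, u ^ (2 * c + 1) * (u - t₁) ^ (2 * d + 1) := by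
    apply intervalIntegral.integral_nonneg h12
    intro u hu
    have : 0 ≤ u := by linarith [hu.1]
    have : 0 ≤ u - t₁ := by linarith [hu.1]
    positivity
  have h3 : ∫ u in t₂..1, u ^ (2 * c + 1) * (u - t₂) ^ (2 * d + 1)
      ≤ ∫ u in t₂..1, u ^ (2 * c + 1) * (u - t₁) ^ (2 * d + 1) := by
    apply intervalIntegral.integral_mono_on h2 ((hc t₂).intervalIntegrable _ _) ((hc t₁).intervalIntegrable _ _)
    intro u hu
    apply mul_le_mul_of_nonneg_left _ (pow_nonneg (by linarith [hu.1]) _)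
    exact (Odd.pow_le_pow (odd_two_mul_add_one d)).mpr (by linarith)
  linarith

/-- Auxiliary lemma `pieceR_antitone` of the Bui–Hall sign-conjecture leg (Lemma C — part 2: (a) `F` strictly increasing on `[0,1]` (hence `h_{c,d}` strictly decreasing), (b)); statement as displayed, box port verbatim. [cite: BuiHall2023, §1 Conjecture 1 — a step of THIS TREE's proof of it (box write-up paper-v3-d979a68f Lemma C — part 2: (a) `F` strictly increasing on `[0;1]` (hence `h_{c;); the cited paper states the conjecture and the proof is ours] -/
theorem pieceR_antitone {t₁ t₂ : ℝ} (h0 : 0 ≤ t₁) (h12 : t₁ ≤ t₂) (h2 : t₂ ≤ 1) :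
    pieceR c d t₂ ≤ pieceR c d t₁ := by
  unfold pieceR
  have hc : ∀ s : ℝ, Continuous fun z : ℝ => (z - s) ^ (2 * c + 1) * z ^ (2 * d + 1) := by
    intro s; fun_prop
  rw [← intervalIntegral.integral_add_adjacent_intervals ((hc t₁).intervalIntegrable t₁ t₂)
    ((hc t₁).intervalIntegrable t₂ 1)]
  have h1 : 0 ≤ ∫ z in t₁..t₂, (z - t₁) ^ (2 * c + 1) * z ^ (2 * d + 1) := by
    apply intervalIntegral.integral_nonneg h12
    intro z hz
    have : 0 ≤ z := by linarith [hz.1]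
    have : 0 ≤ z - t₁ := by linarith [hz.1]
    positivity
  have h3 : ∫ z in t₂..1, (z - t₂) ^ (2 * c + 1) * z ^ (2 * d + 1)
      ≤ ∫ z in t₂..1, (z - t₁) ^ (2 * c + 1) * z ^ (2 * d + 1) := by
    apply intervalIntegral.integral_mono_on h2 ((hc t₂).intervalIntegrable _ _) ((hc t₁).intervalIntegrable _ _)
    intro z hz
    apply mul_le_mul_of_nonneg_right _ (pow_nonneg (by linarith [hz.1]) _)
    exact (Odd.pow_le_pow (odd_two_mul_add_one c)).mpr (by linarith)
  linarith

/-- **Lemma C (a), conclusion**: `F_{c,d}` is strictly increasing on `[0,1]` … [cite: BuiHall2023, §1 Conjecture 1 — a step of THIS TREE's proof of it (box write-up paper-v3-d979a68f Lemma C — part 2: (a) `F` strictly increasing on `[0;1]` (hence `h_{c;); the cited paper states the conjecture and the proof is ours] -/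
theorem Fcd_strictMonoOn : StrictMonoOn (Fcd c d) (Icc 0 1) := by
  intro t₁ ht₁ t₂ ht₂ h12
  rw [Fcd_split, Fcd_split]
  have hA := pieceA_lt c d ht₁.1 h12
  have hP := pieceP_antitone c d ht₁.1 h12.le ht₂.2
  have hR := pieceR_antitone c d ht₁.1 h12.le ht₂.2
  linarith

/-- … thus `h_{c,d}` is strictly decreasing on `[0,1]`. [cite: BuiHall2023, §1 Conjecture 1 — a step of THIS TREE's proof of it (box write-up paper-v3-d979a68f Lemma C — part 2: (a) `F` strictly increasing on `[0;1]` (hence `h_{c;); the cited paper states the conjecture and the proof is ours] -/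
theorem hcd_strictAntiOn : StrictAntiOn (hcd c d) (Icc 0 1) := by
  intro t₁ ht₁ t₂ ht₂ h12
  rw [hcd_eq_neg_Fcd c d ht₁.1 (by linarith [ht₁.2]), hcd_eq_neg_Fcd c d ht₂.1 (by linarith [ht₂.2])]
  have := Fcd_strictMonoOn c d ht₁ ht₂ h12
  linarith

/-- the constant `β_{c,d} = ∫_0^1 y^{2c+1} (1-y)^{2d+1} dy` of Lemma C (b) [folklore] -/
noncomputable def betaCD : ℝ := ∫ y in (0:ℝ)..1, y ^ (2 * c + 1) * (1 - y) ^ (2 * d + 1)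

/-- Lemma C (b), first inequality: `F(1+s) ≥ (1-s)^{2c+2d+3} β` [cite: BuiHall2023, §1 Conjecture 1 — a step of THIS TREE's proof of it (box write-up paper-v3-d979a68f Lemma C — part 2: (a) `F` strictly increasing on `[0;1]` (hence `h_{c;); the cited paper states the conjecture and the proof is ours] -/
theorem Fcd_one_add_ge {s : ℝ} (hs0 : 0 ≤ s) (hs1 : s ≤ 1) :
    (1 - s) ^ (2 * c + 2 * d + 3) * betaCD c d ≤ Fcd c d (1 + s) := by
  rw [Fcd_eq, show 1 + s - 1 = s by ring]
  -- substitution u = (1-s) y + s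
  have hsub := intervalIntegral.smul_integral_comp_mul_add (fun u => gF c d (1 + s) u) (1 - s) s (a := 0) (b := 1)
  simp only [mul_zero, zero_add, mul_one, sub_add_cancel, smul_eq_mul] at hsub
  rw [← hsub]
  have hmono : ∫ y in (0:ℝ)..1, (1 - s) ^ (2 * c + 2 * d + 2) * (y ^ (2 * c + 1) * (1 - y) ^ (2 * d + 1))
      ≤ ∫ y in (0:ℝ)..1, gF c d (1 + s) ((1 - s) * y + s) := by
    apply intervalIntegral.integral_mono_on zero_le_one (Continuous.intervalIntegrable (by fun_prop) _ _)
      (Continuous.intervalIntegrable (by unfold gF; fun_prop) _ _)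
    intro y hy
    simp only [gF]
    have e : (1 - s) ^ (2 * c + 2 * d + 2) * (y ^ (2 * c + 1) * (1 - y) ^ (2 * d + 1))
        = ((1 - s) * y) ^ (2 * c + 1) * ((1 - s) * (1 - y)) ^ (2 * d + 1) := by
      rw [mul_pow, mul_pow]; ring
    rw [e]
    have hy0 := hy.1; have hy1 := hy.2
    have h1s : 0 ≤ 1 - s := by linarith
    apply mul_le_mul
    · exact pow_le_pow_left₀ (by positivity) (by nlinarith) _
    · exact pow_le_pow_left₀ (by nlinarith) (by nlinarith) _
    · positivity
    · apply pow_nonneg; nlinarith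
  rw [intervalIntegral.integral_const_mul] at hmono
  unfold betaCD
  have h1s : 0 ≤ 1 - s := by linarith
  calc (1 - s) ^ (2 * c + 2 * d + 3) * ∫ y in (0:ℝ)..1, y ^ (2 * c + 1) * (1 - y) ^ (2 * d + 1)
      = (1 - s) * ((1 - s) ^ (2 * c + 2 * d + 2) * ∫ y in (0:ℝ)..1, y ^ (2 * c + 1) * (1 - y) ^ (2 * d + 1)) := by
        ring
    _ ≤ (1 - s) * ∫ y in (0:ℝ)..1, gF c d (1 + s) ((1 - s) * y + s) := mul_le_mul_of_nonneg_left hmono h1s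

/-- Lemma C (b), second inequality: `(1-s)^{2c+2d+3} β ≥ F(1-s)` [cite: BuiHall2023, §1 Conjecture 1 — a step of THIS TREE's proof of it (box write-up paper-v3-d979a68f Lemma C — part 2: (a) `F` strictly increasing on `[0;1]` (hence `h_{c;); the cited paper states the conjecture and the proof is ours] -/
theorem Fcd_one_sub_le {s : ℝ} (hs0 : 0 ≤ s) (hs1 : s ≤ 1) :
    Fcd c d (1 - s) ≤ (1 - s) ^ (2 * c + 2 * d + 3) * betaCD c d := by
  rw [Fcd_eq, show 1 - s - 1 = -s by ring]
  have hII := gF_intervalIntegrable c d (1 - s)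
  rw [← intervalIntegral.integral_add_adjacent_intervals (hII (-s) 0) (hII 0 1),
    ← intervalIntegral.integral_add_adjacent_intervals (hII 0 (1 - s)) (hII (1 - s) 1)]
  -- the two outer pieces are ≤ 0
  have h1 : ∫ u in (-s)..0, gF c d (1 - s) u ≤ 0 := by
    have : 0 ≤ ∫ u in (-s)..0, -gF c d (1 - s) u := by
      apply intervalIntegral.integral_nonneg (by linarith)
      intro u hu
      simp only [gF]
      have hu0 : u ≤ 0 := hu.2
      have hpow : u ^ (2 * c + 1) ≤ 0 := (Odd.pow_nonpos_iff (odd_two_mul_add_one c)).mpr hu0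
      have hq : 0 ≤ (1 - s - u) ^ (2 * d + 1) := pow_nonneg (by linarith [hu.1]) _
      nlinarith [mul_nonpos_of_nonpos_of_nonneg hpow hq]
    rw [intervalIntegral.integral_neg] at this; linarith
  have h3 : ∫ u in (1 - s)..1, gF c d (1 - s) u ≤ 0 := by
    have : 0 ≤ ∫ u in (1 - s)..1, -gF c d (1 - s) u := by
      apply intervalIntegral.integral_nonneg (by linarith)
      intro u hu
      simp only [gF]
      have hpow : 0 ≤ u ^ (2 * c + 1) := pow_nonneg (by linarith [hu.1]) _
      have hq : (1 - s - u) ^ (2 * d + 1) ≤ 0 :=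
        (Odd.pow_nonpos_iff (odd_two_mul_add_one d)).mpr (by linarith [hu.1])
      nlinarith [mul_nonpos_of_nonneg_of_nonpos hpow hq]
    rw [intervalIntegral.integral_neg] at this; linarith
  -- the middle piece is exactly (1-s)^{2c+2d+3} β  (u = (1-s) y)
  have h2 : ∫ u in (0:ℝ)..(1 - s), gF c d (1 - s) u = (1 - s) ^ (2 * c + 2 * d + 3) * betaCD c d := by
    have hsub := intervalIntegral.smul_integral_comp_mul_add (fun u => gF c d (1 - s) u) (1 - s) 0 (a := 0) (b := 1)
    simp only [mul_zero, add_zero, mul_one, smul_eq_mul] at hsub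
    rw [← hsub, betaCD, ← intervalIntegral.integral_const_mul, ← intervalIntegral.integral_const_mul]
    apply intervalIntegral.integral_congr; intro y _
    simp only [gF]
    rw [show (1:ℝ) - s - (1 - s) * y = (1 - s) * (1 - y) by ring, mul_pow, mul_pow]; ring
  linarith

/-- **Lemma C (b), conclusion**: `h_{c,d}(1+s) ≤ h_{c,d}(1-s)` for `0 ≤ s ≤ 1` [cite: BuiHall2023, §1 Conjecture 1 — a step of THIS TREE's proof of it (box write-up paper-v3-d979a68f Lemma C — part 2: (a) `F` strictly increasing on `[0;1]` (hence `h_{c;); the cited paper states the conjecture and the proof is ours] -/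
theorem hcd_one_add_le {s : ℝ} (hs0 : 0 ≤ s) (hs1 : s ≤ 1) : hcd c d (1 + s) ≤ hcd c d (1 - s) := by
  rw [hcd_eq_neg_Fcd c d (by linarith) (by linarith), hcd_eq_neg_Fcd c d (by linarith) (by linarith)]
  have := Fcd_one_add_ge c d hs0 hs1
  have := Fcd_one_sub_le c d hs0 hs1
  linarith

/-- condition (C) of Proposition oddodd holds for every pair (Lemma C (a),(b)) [cite: BuiHall2023, §1 Conjecture 1 — a step of THIS TREE's proof of it (box write-up paper-v3-d979a68f Lemma C — part 2: (a) `F` strictly increasing on `[0;1]` (hence `h_{c;); the cited paper states the conjecture and the proof is ours] -/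
theorem condC_holds : CondC c d :=
  ⟨hcd_strictAntiOn c d, fun s hs => hcd_one_add_le c d hs.1 hs.2⟩

end lemmaC2


/-! ## Lemma C — part 3: `∫_0^2 h_{c,d} = 0` (the Fubini step "`∫_{-2}^{2} h_{c,d} = -∫ u₁^{2c+1} u₂^{2d+1} = 0`") -/

section lemmaC3
variable (c d : ℕ)

/-- lower-cut analogue of `intervalIntegral.integral_indicator` [cite: BuiHall2023, §1 Conjecture 1 — a step of THIS TREE's proof of it (box write-up paper-v3-d979a68f Lemma C — part 3: `∫_0^2 h_{cd} = 0` (the Fubini step "`∫_{-2}^{2} h_); the cited paper states the conjecture and the proof is ours] -/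
theorem integral_indicator_Ici {a₁ a₂ a₃ : ℝ} (h : a₂ ∈ Icc a₁ a₃) (f : ℝ → ℝ) :
    ∫ x in a₁..a₃, Set.indicator (Ici a₂) f x = ∫ x in a₂..a₃, f x := by
  rw [intervalIntegral.integral_of_le (h.1.trans h.2), intervalIntegral.integral_of_le h.2,
    MeasureTheory.integral_indicator measurableSet_Ici, Measure.restrict_restrict measurableSet_Ici]
  rcases eq_or_lt_of_le h.1 with heq | hlt
  · subst heq
    have : Ici a₁ ∩ Ioc a₁ a₃ = Ioc a₁ a₃ := by
      ext x; simp only [mem_inter_iff, mem_Ici, mem_Ioc]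
      constructor
      · rintro ⟨_, h2, h3⟩; exact ⟨h2, h3⟩
      · rintro ⟨h2, h3⟩; exact ⟨h2.le, h2, h3⟩
    rw [this]
  · have : Ici a₂ ∩ Ioc a₁ a₃ = Icc a₂ a₃ := by
      ext x; simp only [mem_inter_iff, mem_Ici, mem_Ioc, mem_Icc]
      constructor
      · rintro ⟨h1, _, h3⟩; exact ⟨h1, h3⟩
      · rintro ⟨h1, h3⟩; exact ⟨h1, by linarith, h3⟩
    rw [this, MeasureTheory.integral_Icc_eq_integral_Ioc]

/-- the integrand of `F` cut off below the moving endpoint: `1[t-1 ≤ u] u^{2c+1}(t-u)^{2d+1}` [folklore] -/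
noncomputable def Gsq (t u : ℝ) : ℝ := if t - 1 ≤ u then gF c d t u else 0

/-- Auxiliary lemma `Gsq_eq_indicator_u` of the Bui–Hall sign-conjecture leg (Lemma C — part 3: `∫_0^2 h_{c,d} = 0` (the Fubini step "`∫_{-2}^{2} h_{c,d} = -∫ u₁^{2c+1} u₂^{2d+1} = 0`")); statement as displayed, box port verbatim. [cite: BuiHall2023, §1 Conjecture 1 — a step of THIS TREE's proof of it (box write-up paper-v3-d979a68f Lemma C — part 3: `∫_0^2 h_{cd} = 0` (the Fubini step "`∫_{-2}^{2} h_); the cited paper states the conjecture and the proof is ours] -/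
theorem Gsq_eq_indicator_u (t : ℝ) : (fun u => Gsq c d t u) = Set.indicator (Ici (t - 1)) (gF c d t) := by
  ext u; simp only [Gsq, Set.indicator_apply, mem_Ici]

/-- Auxiliary lemma `Gsq_eq_indicator_t` of the Bui–Hall sign-conjecture leg (Lemma C — part 3: `∫_0^2 h_{c,d} = 0` (the Fubini step "`∫_{-2}^{2} h_{c,d} = -∫ u₁^{2c+1} u₂^{2d+1} = 0`")); statement as displayed, box port verbatim. [cite: BuiHall2023, §1 Conjecture 1 — a step of THIS TREE's proof of it (box write-up paper-v3-d979a68f Lemma C — part 3: `∫_0^2 h_{cd} = 0` (the Fubini step "`∫_{-2}^{2} h_); the cited paper states the conjecture and the proof is ours] -/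
theorem Gsq_eq_indicator_t (u : ℝ) :
    (fun t => Gsq c d t u) = Set.indicator {t | t ≤ u + 1} (fun t => gF c d t u) := by
  ext t
  simp only [Gsq, Set.indicator_apply, mem_setOf_eq]
  by_cases h : t - 1 ≤ u
  · rw [if_pos h, if_pos (by linarith)]
  · rw [if_neg h, if_neg (by intro h'; exact h (by linarith))]

/-- outer representation: `F(t) = ∫_{-1}^{1} G(t,u) du` for `t ∈ [0,2]` [cite: BuiHall2023, §1 Conjecture 1 — a step of THIS TREE's proof of it (box write-up paper-v3-d979a68f Lemma C — part 3: `∫_0^2 h_{cd} = 0` (the Fubini step "`∫_{-2}^{2} h_); the cited paper states the conjecture and the proof is ours] -/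
theorem Fcd_eq_integral_Gsq {t : ℝ} (ht : t ∈ Icc (0:ℝ) 2) : Fcd c d t = ∫ u in (-1:ℝ)..1, Gsq c d t u := by
  rw [show (fun u => Gsq c d t u) = _ from Gsq_eq_indicator_u c d t]
  rw [integral_indicator_Ici ⟨by linarith [ht.1], by linarith [ht.2]⟩, Fcd_eq]

/-- inner value: `∫_0^2 G(t,u) dt = u^{2c+1} (1 - u^{2d+2}) / (2d+2)` for `u ∈ [-1,1]` [cite: BuiHall2023, §1 Conjecture 1 — a step of THIS TREE's proof of it (box write-up paper-v3-d979a68f Lemma C — part 3: `∫_0^2 h_{cd} = 0` (the Fubini step "`∫_{-2}^{2} h_); the cited paper states the conjecture and the proof is ours] -/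
theorem integral_Gsq_t {u : ℝ} (hu : u ∈ Icc (-1:ℝ) 1) :
    ∫ t in (0:ℝ)..2, Gsq c d t u = u ^ (2 * c + 1) * (1 - u ^ (2 * d + 2)) / (2 * d + 2) := by
  rw [show (fun t => Gsq c d t u) = _ from Gsq_eq_indicator_t c d u]
  rw [intervalIntegral.integral_indicator (⟨by linarith [hu.1], by linarith [hu.2]⟩ : u + 1 ∈ Icc (0:ℝ) 2)]
  simp only [gF]
  rw [intervalIntegral.integral_const_mul]
  rw [intervalIntegral.integral_comp_sub_right (fun w => w ^ (2 * d + 1)) u, integral_pow]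
  rw [show (0:ℝ) - u = -u by ring, show u + 1 - u = 1 by ring, one_pow,
    show 2 * d + 1 + 1 = 2 * d + 2 by ring, Even.neg_pow ⟨d + 1, by ring⟩]
  push_cast
  ring

/-- Auxiliary lemma `integrableOn_Gsq` of the Bui–Hall sign-conjecture leg (Lemma C — part 3: `∫_0^2 h_{c,d} = 0` (the Fubini step "`∫_{-2}^{2} h_{c,d} = -∫ u₁^{2c+1} u₂^{2d+1} = 0`")); statement as displayed, box port verbatim. [cite: BuiHall2023, §1 Conjecture 1 — a step of THIS TREE's proof of it (box write-up paper-v3-d979a68f Lemma C — part 3: `∫_0^2 h_{cd} = 0` (the Fubini step "`∫_{-2}^{2} h_); the cited paper states the conjecture and the proof is ours] -/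
theorem integrableOn_Gsq :
    IntegrableOn (Function.uncurry (Gsq c d)) (Set.uIoc (0:ℝ) 2 ×ˢ Set.uIoc (-1:ℝ) 1) := by
  have hset : MeasurableSet {p : ℝ × ℝ | p.1 - 1 ≤ p.2} :=
    measurableSet_le (measurable_fst.sub measurable_const) measurable_snd
  have heq : Function.uncurry (Gsq c d) = Set.indicator {p : ℝ × ℝ | p.1 - 1 ≤ p.2} (Function.uncurry (gF c d)) := by
    ext ⟨t, u⟩; simp only [Function.uncurry, Gsq, Set.indicator_apply, mem_setOf_eq]
  rw [heq]
  apply IntegrableOn.indicator _ hset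
  have hK : IsCompact (Icc (0:ℝ) 2 ×ˢ Icc (-1:ℝ) 1) := isCompact_Icc.prod isCompact_Icc
  have hint : IntegrableOn (Function.uncurry (gF c d)) (Icc (0:ℝ) 2 ×ˢ Icc (-1:ℝ) 1) :=
    (gF_continuous c d).continuousOn.integrableOn_compact hK
  apply hint.mono_set
  rw [Set.uIoc_of_le (by norm_num : (0:ℝ) ≤ 2), Set.uIoc_of_le (by norm_num : (-1:ℝ) ≤ 1)]
  exact Set.prod_mono Ioc_subset_Icc_self Ioc_subset_Icc_self

/-- `∫_0^2 F_{c,d} = 0` [cite: BuiHall2023, §1 Conjecture 1 — a step of THIS TREE's proof of it (box write-up paper-v3-d979a68f Lemma C — part 3: `∫_0^2 h_{cd} = 0` (the Fubini step "`∫_{-2}^{2} h_); the cited paper states the conjecture and the proof is ours] -/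
theorem integral_Fcd_zero_two : ∫ t in (0:ℝ)..2, Fcd c d t = 0 := by
  have h1 : ∫ t in (0:ℝ)..2, Fcd c d t = ∫ t in (0:ℝ)..2, ∫ u in (-1:ℝ)..1, Gsq c d t u := by
    apply intervalIntegral.integral_congr
    intro t ht
    rw [Set.uIcc_of_le (by norm_num : (0:ℝ) ≤ 2)] at ht
    exact Fcd_eq_integral_Gsq c d ht
  rw [h1, MeasureTheory.intervalIntegral_intervalIntegral_swap (integrableOn_Gsq c d)]
  have h2 : ∫ u in (-1:ℝ)..1, ∫ t in (0:ℝ)..2, Gsq c d t u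
      = ∫ u in (-1:ℝ)..1, (u ^ (2 * c + 1) * (1 - u ^ (2 * d + 2)) / (2 * d + 2)) := by
    apply intervalIntegral.integral_congr
    intro u hu
    rw [Set.uIcc_of_le (by norm_num : (-1:ℝ) ≤ 1)] at hu
    exact integral_Gsq_t c d hu
  rw [h2]
  have h3 : ∀ u : ℝ, u ^ (2 * c + 1) * (1 - u ^ (2 * d + 2)) / (2 * d + 2)
      = (1 / (2 * d + 2)) * u ^ (2 * c + 1) - (1 / (2 * d + 2)) * u ^ (2 * c + 2 * d + 3) := by
    intro u; ring
  simp_rw [h3]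
  have hi1 : IntervalIntegrable (fun u : ℝ => 1 / (2 * (d:ℝ) + 2) * u ^ (2 * c + 1)) volume (-1) 1 := by
    apply Continuous.intervalIntegrable; fun_prop
  have hi2 : IntervalIntegrable (fun u : ℝ => 1 / (2 * (d:ℝ) + 2) * u ^ (2 * c + 2 * d + 3)) volume (-1) 1 := by
    apply Continuous.intervalIntegrable; fun_prop
  rw [intervalIntegral.integral_sub hi1 hi2,
    intervalIntegral.integral_const_mul, intervalIntegral.integral_const_mul, integral_pow, integral_pow]
  rw [show 2 * c + 1 + 1 = 2 * (c + 1) by ring, show 2 * c + 2 * d + 3 + 1 = 2 * (c + d + 2) by ring,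
    Even.neg_pow ⟨c + 1, by ring⟩, Even.neg_pow ⟨c + d + 2, by ring⟩]
  simp

/-- `∫_0^2 h_{c,d} = 0` [cite: BuiHall2023, §1 Conjecture 1 — a step of THIS TREE's proof of it (box write-up paper-v3-d979a68f Lemma C — part 3: `∫_0^2 h_{cd} = 0` (the Fubini step "`∫_{-2}^{2} h_); the cited paper states the conjecture and the proof is ours] -/
theorem integral_hcd_zero_two : ∫ t in (0:ℝ)..2, hcd c d t = 0 := by
  have : ∫ t in (0:ℝ)..2, hcd c d t = ∫ t in (0:ℝ)..2, -Fcd c d t := by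
    apply intervalIntegral.integral_congr
    intro t ht
    rw [Set.uIcc_of_le (by norm_num : (0:ℝ) ≤ 2)] at ht
    exact hcd_eq_neg_Fcd c d ht.1 ht.2
  rw [this, intervalIntegral.integral_neg, integral_Fcd_zero_two, neg_zero]

end lemmaC3


/-! ## Lemma C — part 4: condition (i): `H_{c,d} ≥ 0` on `[0,2]`, `> 0` on `(0,2)` -/

section lemmaC4
variable (c d : ℕ)

/-- Auxiliary lemma `hcd_continuousOn` of the Bui–Hall sign-conjecture leg (Lemma C — part 4: condition (i): `H_{c,d} ≥ 0` on `[0,2]`, `> 0` on `(0,2)`); statement as displayed, box port verbatim. [cite: BuiHall2023, §1 Conjecture 1 — a step of THIS TREE's proof of it (box write-up paper-v3-d979a68f Lemma C — part 4: condition (i): `H_{cd} ≥ 0` on `[0;2]`; `> 0` on `(); the cited paper states the conjecture and the proof is ours] -/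
theorem hcd_continuousOn : ContinuousOn (hcd c d) (Icc 0 2) := by
  apply ((Fcd_continuous c d).neg.continuousOn).congr
  intro t ht
  exact hcd_eq_neg_Fcd c d ht.1 ht.2

/-- Auxiliary lemma `hcd_intervalIntegrable` of the Bui–Hall sign-conjecture leg (Lemma C — part 4: condition (i): `H_{c,d} ≥ 0` on `[0,2]`, `> 0` on `(0,2)`); statement as displayed, box port verbatim. [cite: BuiHall2023, §1 Conjecture 1 — a step of THIS TREE's proof of it (box write-up paper-v3-d979a68f Lemma C — part 4: condition (i): `H_{cd} ≥ 0` on `[0;2]`; `> 0` on `(); the cited paper states the conjecture and the proof is ours] -/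
theorem hcd_intervalIntegrable {a b : ℝ} (ha : a ∈ Icc (0:ℝ) 2) (hb : b ∈ Icc (0:ℝ) 2) :
    IntervalIntegrable (hcd c d) volume a b := by
  apply ContinuousOn.intervalIntegrable
  apply (hcd_continuousOn c d).mono
  intro t ht
  rw [Set.mem_uIcc] at ht
  rcases ht with ⟨h1, h2⟩ | ⟨h1, h2⟩
  · exact ⟨ha.1.trans h1, h2.trans hb.2⟩
  · exact ⟨hb.1.trans h1, h2.trans ha.2⟩

/-- `h_{c,d}(0) > 0` and `h_{c,d} < 0` on `[1,2)` [cite: BuiHall2023, §1 Conjecture 1 — a step of THIS TREE's proof of it (box write-up paper-v3-d979a68f Lemma C — part 4: condition (i): `H_{cd} ≥ 0` on `[0;2]`; `> 0` on `(); the cited paper states the conjecture and the proof is ours] -/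
theorem hcd_zero_pos : 0 < hcd c d 0 := by
  rw [hcd_eq_neg_Fcd c d le_rfl (by norm_num)]; linarith [Fcd_zero_neg c d]

/-- Auxiliary lemma `hcd_neg_of_mem` of the Bui–Hall sign-conjecture leg (Lemma C — part 4: condition (i): `H_{c,d} ≥ 0` on `[0,2]`, `> 0` on `(0,2)`); statement as displayed, box port verbatim. [cite: BuiHall2023, §1 Conjecture 1 — a step of THIS TREE's proof of it (box write-up paper-v3-d979a68f Lemma C — part 4: condition (i): `H_{cd} ≥ 0` on `[0;2]`; `> 0` on `(); the cited paper states the conjecture and the proof is ours] -/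
theorem hcd_neg_of_mem {t : ℝ} (ht1 : 1 ≤ t) (ht2 : t < 2) : hcd c d t < 0 := by
  rw [hcd_eq_neg_Fcd c d (by linarith) ht2.le]; linarith [Fcd_pos_of_mem c d ht1 ht2]

/-- the sign structure of `h_{c,d}` on `[0,2)`: positive below the crossing point `t₀`, negative above it [cite: BuiHall2023, §1 Conjecture 1 — a step of THIS TREE's proof of it (box write-up paper-v3-d979a68f Lemma C — part 4: condition (i): `H_{cd} ≥ 0` on `[0;2]`; `> 0` on `(); the cited paper states the conjecture and the proof is ours] -/
theorem hcd_sign_structure : ∃ t₀ ∈ Icc (0:ℝ) 1,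
    (∀ s ∈ Icc (0:ℝ) 2, s < t₀ → 0 < hcd c d s) ∧ (∀ s ∈ Icc (0:ℝ) 2, t₀ < s → s < 2 → hcd c d s < 0) := by
  set S : Set ℝ := {s | s ∈ Icc (0:ℝ) 1 ∧ 0 ≤ hcd c d s} with hS
  have h0S : (0:ℝ) ∈ S := ⟨⟨le_rfl, zero_le_one⟩, (hcd_zero_pos c d).le⟩
  have hne : S.Nonempty := ⟨0, h0S⟩
  have hbdd : BddAbove S := ⟨1, fun s hs => hs.1.2⟩
  have anti := hcd_strictAntiOn c d
  refine ⟨sSup S, ⟨le_csSup hbdd h0S, csSup_le hne fun s hs => hs.1.2⟩, ?_, ?_⟩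
  · intro s hs hlt
    obtain ⟨s', hs'S, hss'⟩ := exists_lt_of_lt_csSup hne hlt
    have hs1 : s ∈ Icc (0:ℝ) 1 := ⟨hs.1, by linarith [hs'S.1.2]⟩
    have := anti hs1 hs'S.1 hss'
    linarith [hs'S.2]
  · intro s hs hgt hs2
    by_cases h1 : 1 ≤ s
    · exact hcd_neg_of_mem c d h1 hs2
    · have h1' : s < 1 := not_le.mp h1
      by_contra hcon
      have hcon' : 0 ≤ hcd c d s := not_lt.mp hcon
      have hsS : s ∈ S := ⟨⟨hs.1, h1'.le⟩, hcon'⟩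
      have := le_csSup hbdd hsS
      linarith

/-- **Lemma C (c), conclusion = condition (i) of Proposition 11family** [cite: BuiHall2023, §1 Conjecture 1 — a step of THIS TREE's proof of it (box write-up paper-v3-d979a68f Lemma C — part 4: condition (i): `H_{cd} ≥ 0` on `[0;2]`; `> 0` on `(); the cited paper states the conjecture and the proof is ours] -/
theorem condI_holds : CondI c d := by
  obtain ⟨t₀, ht₀, hpos, hneg⟩ := hcd_sign_structure c d
  have hII := fun a b (ha : a ∈ Icc (0:ℝ) 2) (hb : b ∈ Icc (0:ℝ) 2) => hcd_intervalIntegrable c d ha hb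
  have m0 : (0:ℝ) ∈ Icc (0:ℝ) 2 := ⟨le_rfl, by norm_num⟩
  have m2 : (2:ℝ) ∈ Icc (0:ℝ) 2 := ⟨by norm_num, le_rfl⟩
  -- positivity on (0,2)
  have key : ∀ t ∈ Ioo (0:ℝ) 2, 0 < Hcd c d t := by
    intro t ht
    have mt : t ∈ Icc (0:ℝ) 2 := ⟨ht.1.le, ht.2.le⟩
    unfold Hcd
    rcases le_or_gt t t₀ with hle | hgt
    · -- ∫_0^t h > 0 : h > 0 on (0,t)
      apply intervalIntegral.intervalIntegral_pos_of_pos_on (hII 0 t m0 mt) _ ht.1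
      intro s hs
      exact hpos s ⟨hs.1.le, by linarith [hs.2, ht.2]⟩ (lt_of_lt_of_le hs.2 hle)
    · -- ∫_0^t h = ∫_0^2 h - ∫_t^2 h = -∫_t^2 h > 0
      have hsplit := intervalIntegral.integral_add_adjacent_intervals (hII 0 t m0 mt) (hII t 2 mt m2)
      rw [integral_hcd_zero_two] at hsplit
      have hneg' : 0 < ∫ s in t..2, -hcd c d s := by
        apply intervalIntegral.intervalIntegral_pos_of_pos_on (hII t 2 mt m2).neg _ ht.2
        intro s hs
        have := hneg s ⟨by linarith [hs.1, ht.1], hs.2.le⟩ (lt_trans hgt hs.1) hs.2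
        simp only [Pi.neg_apply]
        linarith
      rw [intervalIntegral.integral_neg] at hneg'
      linarith
  refine ⟨?_, key⟩
  intro t ht
  rcases eq_or_lt_of_le ht.1 with h0 | h0
  · rw [← h0]; simp [Hcd]
  rcases eq_or_lt_of_le ht.2 with h2 | h2
  · rw [h2]; unfold Hcd; rw [integral_hcd_zero_two]
  exact (key t ⟨h0, h2⟩).le

/-- Lemma C for every pair: (C) and (i) [cite: BuiHall2023, §1 Conjecture 1 — a step of THIS TREE's proof of it (box write-up paper-v3-d979a68f Lemma C — part 4: condition (i): `H_{cd} ≥ 0` on `[0;2]`; `> 0` on `(); the cited paper states the conjecture and the proof is ours] -/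
theorem lemmaC_conclusions : LemmaCConclusions := fun c d => ⟨condC_holds c d, condI_holds c d⟩

end lemmaC4


/-! ## Proposition oddodd — the analytic step ("the integral is negative"), proved: `OddOddCore` -/

section oddodd
variable (c d : ℕ)

/-- `h_{c,d}` is continuous on `ℝ` (a parametric integral with continuously moving endpoints) [cite: BuiHall2023, §1 Conjecture 1 — a step of THIS TREE's proof of it (box write-up paper-v3-d979a68f Proposition oddodd — the analytic step ("the integral is negative"); p); the cited paper states the conjecture and the proof is ours] -/
theorem hcd_continuous : Continuous (hcd c d) := by
  have hP : Continuous (Function.uncurry fun (t x : ℝ) => (t / 2 + x) ^ (2 * c + 1) * (t / 2 - x) ^ (2 * d + 1)) := by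
    unfold Function.uncurry; fun_prop
  have hl : Continuous fun t : ℝ => 1 - |t| / 2 := by fun_prop
  have h1 := intervalIntegral.continuous_parametric_intervalIntegral_of_continuous (μ := volume) (a₀ := (0:ℝ)) hP hl
  have h2 := intervalIntegral.continuous_parametric_intervalIntegral_of_continuous (μ := volume) (a₀ := (0:ℝ)) hP hl.neg
  have e : hcd c d = fun t => -((∫ x in (0:ℝ)..(1 - |t| / 2), (t / 2 + x) ^ (2 * c + 1) * (t / 2 - x) ^ (2 * d + 1))
      - ∫ x in (0:ℝ)..(-(1 - |t| / 2)), (t / 2 + x) ^ (2 * c + 1) * (t / 2 - x) ^ (2 * d + 1)) := by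
    ext t
    unfold hcd
    have hI : ∀ a b : ℝ, IntervalIntegrable (fun x : ℝ => (t / 2 + x) ^ (2 * c + 1) * (t / 2 - x) ^ (2 * d + 1)) volume a b :=
      fun a b => Continuous.intervalIntegrable (by fun_prop) a b
    rw [intervalIntegral.integral_interval_sub_left (hI _ _) (hI _ _)]
  rw [e]
  exact (h1.sub h2).neg

/-- the pointwise comparison of Proposition oddodd: `h(|u-v|) ≥ h(u+v)` on `[0,1]²` under (C) [cite: BuiHall2023, §1 Conjecture 1 — a step of THIS TREE's proof of it (box write-up paper-v3-d979a68f Proposition oddodd — the analytic step ("the integral is negative"); p); the cited paper states the conjecture and the proof is ours] -/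
theorem hcd_abs_sub_ge (hC : CondC c d) {u v : ℝ} (hu : u ∈ Icc (0:ℝ) 1) (hv : v ∈ Icc (0:ℝ) 1) :
    hcd c d (u + v) ≤ hcd c d |u - v| := by
  obtain ⟨anti, half⟩ := hC
  have hanti := anti.antitoneOn
  have habs0 : 0 ≤ |u - v| := abs_nonneg _
  have habs1 : |u - v| ≤ 1 := by rw [abs_le]; constructor <;> linarith [hu.1, hu.2, hv.1, hv.2]
  have hsum : |u - v| + (u + v) ≤ 2 := by
    rcases le_total u v with h | h
    · rw [abs_of_nonpos (by linarith)]; linarith [hv.2]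
    · rw [abs_of_nonneg (by linarith)]; linarith [hu.2]
  have hle : |u - v| ≤ u + v := by rw [abs_le]; constructor <;> linarith [hu.1, hv.1]
  rcases le_or_gt (u + v) 1 with h1 | h1
  · exact hanti ⟨habs0, habs1⟩ ⟨by linarith [hu.1, hv.1], h1⟩ hle
  · -- t₂ = u+v > 1 : h(t₁) ≥ h(2 - t₂) ≥ h(t₂)
    have hA : hcd c d (2 - (u + v)) ≤ hcd c d |u - v| :=
      hanti ⟨habs0, habs1⟩ ⟨by linarith [hu.2, hv.2], by linarith⟩ (by linarith)
    have hB := half (u + v - 1) ⟨by linarith, by linarith [hu.2, hv.2]⟩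
    rw [show 1 + (u + v - 1) = u + v by ring, show 1 - (u + v - 1) = 2 - (u + v) by ring] at hB
    exact hB.trans hA

/-- folding the square `[-1,1]²` onto `[0,1]²` for the odd–odd monomial (uses that `h_{c,d}` is even) [cite: BuiHall2023, §1 Conjecture 1 — a step of THIS TREE's proof of it (box write-up paper-v3-d979a68f Proposition oddodd — the analytic step ("the integral is negative"); p); the cited paper states the conjecture and the proof is ours] -/
theorem Tint_odd_fold (a b : ℕ) :
    Tint c d (2 * a + 1) (2 * b + 1) = 2 * ∫ u in (0:ℝ)..1, ∫ v in (0:ℝ)..1,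
      u ^ (2 * a + 1) * v ^ (2 * b + 1) * (hcd c d (u + v) - hcd c d |u - v|) := by
  have hcont := hcd_continuous c d
  set f : ℝ → ℝ → ℝ := fun u v => u ^ (2 * a + 1) * v ^ (2 * b + 1) * hcd c d (u + v) with hf
  have hfc : Continuous (Function.uncurry f) := by
    simp only [hf, Function.uncurry]; fun_prop
  -- inner fold
  have inner : ∀ u : ℝ, ∫ v in (-1:ℝ)..1, f u v = ∫ v in (0:ℝ)..1, (f u v + f u (-v)) := by
    intro u
    have hI : ∀ p q : ℝ, IntervalIntegrable (f u) volume p q := fun p q =>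
      (hfc.comp (Continuous.prodMk_right u)).intervalIntegrable p q
    rw [← intervalIntegral.integral_add_adjacent_intervals (hI (-1) 0) (hI 0 1)]
    have hneg : ∫ v in (-1:ℝ)..0, f u v = ∫ v in (0:ℝ)..1, f u (-v) := by
      rw [intervalIntegral.integral_comp_neg (fun v => f u v)]; simp
    have hc2 : Continuous fun v => f u (-v) := by
      exact hfc.comp ((Continuous.prodMk_right u).comp continuous_neg)
    rw [hneg, add_comm, ← intervalIntegral.integral_add (hI 0 1) (hc2.intervalIntegrable 0 1)]
  -- outer fold
  set g : ℝ → ℝ := fun u => ∫ v in (0:ℝ)..1, (f u v + f u (-v)) with hg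
  have hgc : Continuous g := by
    have : Continuous (Function.uncurry fun (u v : ℝ) => f u v + f u (-v)) := by
      simp only [hf, Function.uncurry]; fun_prop
    exact intervalIntegral.continuous_parametric_intervalIntegral_of_continuous' this 0 1
  have outer : ∫ u in (-1:ℝ)..1, g u = ∫ u in (0:ℝ)..1, (g u + g (-u)) := by
    rw [← intervalIntegral.integral_add_adjacent_intervals (hgc.intervalIntegrable (-1) 0) (hgc.intervalIntegrable 0 1)]
    have hneg : ∫ u in (-1:ℝ)..0, g u = ∫ u in (0:ℝ)..1, g (-u) := by
      rw [intervalIntegral.integral_comp_neg (fun u => g u)]; simp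
    have hc3 : Continuous fun u => g (-u) := by exact hgc.comp continuous_neg
    rw [hneg, add_comm, ← intervalIntegral.integral_add (hgc.intervalIntegrable 0 1) (hc3.intervalIntegrable 0 1)]
  unfold Tint
  simp_rw [show ∀ u v : ℝ, u ^ (2 * a + 1) * v ^ (2 * b + 1) * hcd c d (u + v) = f u v from fun u v => rfl]
  simp_rw [inner]
  change ∫ u in (-1:ℝ)..1, g u = _
  rw [outer, ← intervalIntegral.integral_const_mul]
  apply intervalIntegral.integral_congr; intro u _
  simp only [hg]
  have hI2 : ∀ w : ℝ, IntervalIntegrable (fun v => f w v + f w (-v)) volume 0 1 := fun w =>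
    Continuous.intervalIntegrable (by simp only [hf]; fun_prop) 0 1
  rw [← intervalIntegral.integral_add (hI2 u) (hI2 (-u)), ← intervalIntegral.integral_const_mul]
  apply intervalIntegral.integral_congr; intro v _
  simp only [hf]
  have e1 : hcd c d (u + -v) = hcd c d |u - v| := by
    rw [← sub_eq_add_neg]
    rcases le_total 0 (u - v) with h | h
    · rw [abs_of_nonneg h]
    · rw [abs_of_nonpos h, ← hcd_even c d (u - v)]
  have e2 : hcd c d (-u + v) = hcd c d |u - v| := by
    rw [show -u + v = -(u - v) by ring, hcd_even]
    rcases le_total 0 (u - v) with h | h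
    · rw [abs_of_nonneg h]
    · rw [abs_of_nonpos h, ← hcd_even c d (u - v)]
  have e3 : hcd c d (-u + -v) = hcd c d (u + v) := by rw [show -u + -v = -(u + v) by ring, hcd_even]
  rw [e1, e2, e3, Odd.neg_pow (odd_two_mul_add_one a), Odd.neg_pow (odd_two_mul_add_one b)]
  ring

/-- **Proposition oddodd, analytic step**: under (C), `∫_{[-1,1]²} u^{2a+1} v^{2b+1} h_{c,d}(u+v) < 0`. [cite: BuiHall2023, §1 Conjecture 1 — a step of THIS TREE's proof of it (box write-up paper-v3-d979a68f Proposition oddodd — the analytic step ("the integral is negative"); p); the cited paper states the conjecture and the proof is ours] -/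
theorem oddOddCore_holds : OddOddCore := by
  intro c d hC a b
  rw [Tint_odd_fold]
  have hcont := hcd_continuous c d
  set F2 : ℝ → ℝ → ℝ := fun u v => u ^ (2 * a + 1) * v ^ (2 * b + 1) * (hcd c d (u + v) - hcd c d |u - v|) with hF2
  have hF2c : Continuous (Function.uncurry F2) := by simp only [hF2, Function.uncurry]; fun_prop
  -- pointwise ≤ 0 on the square
  have hpt : ∀ u ∈ Icc (0:ℝ) 1, ∀ v ∈ Icc (0:ℝ) 1, F2 u v ≤ 0 := by
    intro u hu v hv
    simp only [hF2]
    have h1 : 0 ≤ u ^ (2 * a + 1) * v ^ (2 * b + 1) := by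
      apply mul_nonneg (pow_nonneg hu.1 _) (pow_nonneg hv.1 _)
    have h2 : hcd c d (u + v) - hcd c d |u - v| ≤ 0 := by linarith [hcd_abs_sub_ge c d hC hu hv]
    exact mul_nonpos_of_nonneg_of_nonpos h1 h2
  set I : ℝ → ℝ := fun u => ∫ v in (0:ℝ)..1, F2 u v with hI
  have hIc : Continuous I := intervalIntegral.continuous_parametric_intervalIntegral_of_continuous' hF2c 0 1
  have hIle : ∀ u ∈ Icc (0:ℝ) 1, I u ≤ 0 := by
    intro u hu
    have : 0 ≤ ∫ v in (0:ℝ)..1, -F2 u v :=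
      intervalIntegral.integral_nonneg zero_le_one fun v hv => by linarith [hpt u hu v hv]
    rw [intervalIntegral.integral_neg] at this
    simp only [hI]; linarith
  -- strictness at u = 1/2 (with v = 1/4 : h(3/4) < h(1/4))
  have hIhalf : I (1 / 2) < 0 := by
    simp only [hI]
    have hlt : ∫ v in (0:ℝ)..1, F2 (1 / 2) v < ∫ v in (0:ℝ)..1, (0:ℝ) := by
      refine intervalIntegral.integral_lt_integral_of_continuousOn_of_le_of_exists_lt
        (f := fun v => F2 (1 / 2) v) (g := fun _ => (0:ℝ)) zero_lt_one ?_ continuousOn_const ?_ ?_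
      · exact (hF2c.comp (Continuous.prodMk_right (1 / 2 : ℝ))).continuousOn
      · intro v hv; exact hpt (1 / 2) ⟨by norm_num, by norm_num⟩ v ⟨hv.1.le, hv.2⟩
      · refine ⟨1 / 4, ⟨by norm_num, by norm_num⟩, ?_⟩
        show (1 / 2 : ℝ) ^ (2 * a + 1) * (1 / 4) ^ (2 * b + 1) * (hcd c d (1 / 2 + 1 / 4) - hcd c d |1 / 2 - 1 / 4|) < 0
        rw [show (1 / 2 : ℝ) + 1 / 4 = 3 / 4 by norm_num, show |(1 / 2 : ℝ) - 1 / 4| = 1 / 4 by norm_num]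
        have hs : hcd c d (3 / 4) < hcd c d (1 / 4) :=
          hC.1 ⟨by norm_num, by norm_num⟩ ⟨by norm_num, by norm_num⟩ (by norm_num)
        have hp : (0:ℝ) < (1 / 2) ^ (2 * a + 1) * (1 / 4) ^ (2 * b + 1) := by positivity
        nlinarith
    simpa using hlt
  have hstrict : ∫ u in (0:ℝ)..1, I u < ∫ u in (0:ℝ)..1, (0:ℝ) := by
    refine intervalIntegral.integral_lt_integral_of_continuousOn_of_le_of_exists_lt
      (f := fun u => I u) (g := fun _ => (0:ℝ)) zero_lt_one hIc.continuousOn continuousOn_const ?_ ?_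
    · intro u hu; exact hIle u ⟨hu.1.le, hu.2⟩
    · exact ⟨1 / 2, ⟨by norm_num, by norm_num⟩, hIhalf⟩
  simp only [intervalIntegral.integral_zero] at hstrict
  change 2 * ∫ u in (0:ℝ)..1, I u < 0
  linarith

end oddodd


/-! ## Lemma C (c), sharp form: `h_{c,d}` vanishes exactly once in `(0,2)`, at some `t₀ ∈ (0,1)` -/

section lemmaC5
variable (c d : ℕ)

/-- Auxiliary lemma `pos_near_of_continuous` of the Bui–Hall sign-conjecture leg (Lemma C (c), sharp form: `h_{c,d}` vanishes exactly once in `(0,2)`, at some `t₀ ∈ (0,1)`); statement as displayed, box port verbatim. [cite: BuiHall2023, §1 Conjecture 1 — a step of THIS TREE's proof of it (box write-up paper-v3-d979a68f Lemma C (c); sharp form: `h_{cd}` vanishes exactly once in `(0;2)`; a); the cited paper states the conjecture and the proof is ours] -/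
theorem pos_near_of_continuous {f : ℝ → ℝ} (hf : Continuous f) {a : ℝ} (ha : 0 < f a) :
    ∃ δ > 0, ∀ x, |x - a| < δ → 0 < f x := by
  obtain ⟨δ, hδ, h⟩ := Metric.continuousAt_iff.mp hf.continuousAt (f a) ha
  refine ⟨δ, hδ, fun x hx => ?_⟩
  have := h (by rwa [Real.dist_eq])
  rw [Real.dist_eq] at this
  have := (abs_lt.mp this).1
  linarith

/-- Auxiliary lemma `neg_near_of_continuous` of the Bui–Hall sign-conjecture leg (Lemma C (c), sharp form: `h_{c,d}` vanishes exactly once in `(0,2)`, at some `t₀ ∈ (0,1)`); statement as displayed, box port verbatim. [cite: BuiHall2023, §1 Conjecture 1 — a step of THIS TREE's proof of it (box write-up paper-v3-d979a68f Lemma C (c); sharp form: `h_{cd}` vanishes exactly once in `(0;2)`; a); the cited paper states the conjecture and the proof is ours] -/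
theorem neg_near_of_continuous {f : ℝ → ℝ} (hf : Continuous f) {a : ℝ} (ha : f a < 0) :
    ∃ δ > 0, ∀ x, |x - a| < δ → f x < 0 := by
  obtain ⟨δ, hδ, h⟩ := pos_near_of_continuous (f := fun x => -f x) hf.neg (a := a) (by linarith)
  exact ⟨δ, hδ, fun x hx => by have := h x hx; linarith⟩

/-- **Lemma C (c) as printed**: `h_{c,d}` vanishes exactly once in `(0,2)`, at some `t₀ ∈ (0,1)`, is positive on `[0,t₀)` and
negative on `(t₀,2)`. [cite: BuiHall2023, §1 Conjecture 1 — a step of THIS TREE's proof of it (box write-up paper-v3-d979a68f Lemma C (c); sharp form: `h_{cd}` vanishes exactly once in `(0;2)`; a); the cited paper states the conjecture and the proof is ours] -/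
theorem hcd_unique_zero : ∃ t₀ ∈ Ioo (0:ℝ) 1, hcd c d t₀ = 0 ∧
    (∀ s ∈ Icc (0:ℝ) 2, s < t₀ → 0 < hcd c d s) ∧ (∀ s ∈ Icc (0:ℝ) 2, t₀ < s → s < 2 → hcd c d s < 0) ∧
    (∀ s ∈ Ioo (0:ℝ) 2, hcd c d s = 0 → s = t₀) := by
  obtain ⟨t₀, ht₀, hpos, hneg⟩ := hcd_sign_structure c d
  have hc := hcd_continuous c d
  -- t₀ > 0 : h > 0 near 0, but h < 0 just above t₀ if t₀ were 0
  have ht0 : 0 < t₀ := by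
    by_contra h0
    have h0' : t₀ = 0 := le_antisymm (not_lt.mp h0) ht₀.1
    obtain ⟨δ, hδ, hδp⟩ := pos_near_of_continuous hc (hcd_zero_pos c d)
    set s := min (δ / 2) 1 with hs
    have hs0 : 0 < s := by positivity
    have hs2 : s ≤ 1 := min_le_right _ _
    have h1 := hδp s (by rw [sub_zero, abs_of_pos hs0]; linarith [min_le_left (δ / 2) 1])
    have h2 := hneg s ⟨hs0.le, by linarith⟩ (by rw [h0']; exact hs0) (by linarith)
    linarith
  -- t₀ < 1 : h(1) < 0, so h < 0 just below 1, contradicting h > 0 below t₀ if t₀ were 1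
  have ht1 : t₀ < 1 := by
    by_contra h1
    have h1' : t₀ = 1 := le_antisymm ht₀.2 (not_lt.mp h1)
    obtain ⟨δ, hδ, hδn⟩ := neg_near_of_continuous hc (hcd_neg_of_mem c d le_rfl (by norm_num))
    set s := max (1 - δ / 2) (1 / 2) with hs
    have hs1 : s < 1 := by rw [hs]; apply max_lt <;> linarith
    have hs0 : 0 < s := lt_of_lt_of_le (by norm_num) (le_max_right _ _)
    have hA := hδn s (by
      rw [abs_lt]; constructor <;> [linarith [le_max_left (1 - δ / 2) (1 / 2)]; linarith])
    have hB := hpos s ⟨hs0.le, by linarith⟩ (by rw [h1']; exact hs1)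
    linarith
  -- h(t₀) = 0
  have hz : hcd c d t₀ = 0 := by
    rcases lt_trichotomy (hcd c d t₀) 0 with hlt | heq | hgt
    · obtain ⟨δ, hδ, hδn⟩ := neg_near_of_continuous hc hlt
      set s := max (t₀ - δ / 2) (t₀ / 2) with hs
      have hst : s < t₀ := by rw [hs]; apply max_lt <;> linarith
      have hs0 : 0 < s := lt_of_lt_of_le (by linarith) (le_max_right _ _)
      have hA := hδn s (by
        rw [abs_lt]; constructor <;> [linarith [le_max_left (t₀ - δ / 2) (t₀ / 2)]; linarith])
      have hB := hpos s ⟨hs0.le, by linarith⟩ hst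
      linarith
    · exact heq
    · obtain ⟨δ, hδ, hδp⟩ := pos_near_of_continuous hc hgt
      set s := min (t₀ + δ / 2) ((t₀ + 2) / 2) with hs
      have hst : t₀ < s := by rw [hs]; apply lt_min <;> linarith
      have hs2 : s < 2 := lt_of_le_of_lt (min_le_right _ _) (by linarith)
      have hA := hδp s (by
        rw [abs_lt]; constructor <;> [linarith; linarith [min_le_left (t₀ + δ / 2) ((t₀ + 2) / 2)]])
      have hB := hneg s ⟨by linarith, hs2.le⟩ hst hs2
      linarith
  refine ⟨t₀, ⟨ht0, ht1⟩, hz, hpos, hneg, ?_⟩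
  intro s hs hs0
  rcases lt_trichotomy s t₀ with h | h | h
  · have := hpos s ⟨hs.1.le, hs.2.le⟩ h; linarith
  · exact h
  · have := hneg s ⟨hs.1.le, hs.2.le⟩ h hs.2; linarith

end lemmaC5


/-! ## Corollary signs (a) — all orders even ⇒ `M(k) > 0`, proved: `AllEvenPos`

`M(2a,2b,2c,2d) = (3/16) ∫_{-1}^1∫_{-1}^1∫_{-1}^1 1[|p+q+r| ≤ 1] p^{2a} q^{2b} r^{2c} (-p-q-r)^{2d}`, an iterated integral of a
non-negative integrand; positivity is proved by comparison with the continuous separable minorant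
`ψ_{2a+1}(p) ψ_{2b+1}(q) ψ_{2c+2d+1}(r)`, `ψ_n(s) = (max 0 (s(1/4 - s)))^n` (supported in `[0,1/4]³`, where the indicator is `1`),
after establishing that the inner iterated integrals are integrable (measurable and bounded). -/

section alleven

/-- the bump `ψ_n(s) = (max 0 (s (1/4 - s)))^n` [folklore] -/
noncomputable def psiB (n : ℕ) (s : ℝ) : ℝ := (max 0 (s * (1 / 4 - s))) ^ n

/-- Auxiliary lemma `psiB_continuous` of the Bui–Hall sign-conjecture leg (Corollary signs (a) — all orders even ⇒ `M(k) > 0`, proved: `AllEvenPos`); statement as displayed, box port verbatim. [cite: BuiHall2023, §1 Conjecture 1 — a step of THIS TREE's proof of it (box write-up paper-v3-d979a68f Corollary signs (a) — all orders even ⇒ `M(k) > 0`; proved: `AllEvenPo); the cited paper states the conjecture and the proof is ours] -/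
theorem psiB_continuous (n : ℕ) : Continuous (psiB n) := by unfold psiB; fun_prop
/-- Auxiliary lemma `psiB_nonneg` of the Bui–Hall sign-conjecture leg (Corollary signs (a) — all orders even ⇒ `M(k) > 0`, proved: `AllEvenPos`); statement as displayed, box port verbatim. [cite: BuiHall2023, §1 Conjecture 1 — a step of THIS TREE's proof of it (box write-up paper-v3-d979a68f Corollary signs (a) — all orders even ⇒ `M(k) > 0`; proved: `AllEvenPo); the cited paper states the conjecture and the proof is ours] -/
theorem psiB_nonneg (n : ℕ) (s : ℝ) : 0 ≤ psiB n s := pow_nonneg (le_max_left _ _) _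
/-- Auxiliary lemma `psiB_eq_zero` of the Bui–Hall sign-conjecture leg (Corollary signs (a) — all orders even ⇒ `M(k) > 0`, proved: `AllEvenPos`); statement as displayed, box port verbatim. [cite: BuiHall2023, §1 Conjecture 1 — a step of THIS TREE's proof of it (box write-up paper-v3-d979a68f Corollary signs (a) — all orders even ⇒ `M(k) > 0`; proved: `AllEvenPo); the cited paper states the conjecture and the proof is ours] -/
theorem psiB_eq_zero {n : ℕ} (hn : 1 ≤ n) {s : ℝ} (hs : ¬ (0 < s ∧ s < 1 / 4)) : psiB n s = 0 := by
  unfold psiB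
  have : s * (1 / 4 - s) ≤ 0 := by
    by_cases h0 : 0 < s
    · have : 1 / 4 ≤ s := not_lt.mp (fun h => hs ⟨h0, h⟩); nlinarith
    · have h0' : s ≤ 0 := not_lt.mp h0
      nlinarith
  rw [max_eq_left this, zero_pow (by omega)]
/-- Auxiliary lemma `psiB_le_pow` of the Bui–Hall sign-conjecture leg (Corollary signs (a) — all orders even ⇒ `M(k) > 0`, proved: `AllEvenPos`); statement as displayed, box port verbatim. [cite: BuiHall2023, §1 Conjecture 1 — a step of THIS TREE's proof of it (box write-up paper-v3-d979a68f Corollary signs (a) — all orders even ⇒ `M(k) > 0`; proved: `AllEvenPo); the cited paper states the conjecture and the proof is ours] -/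
theorem psiB_le_pow {n : ℕ} {s : ℝ} (hs : 0 < s ∧ s < 1 / 4) : psiB (n + 1) s ≤ s ^ n := by
  unfold psiB
  have h1 : max 0 (s * (1 / 4 - s)) = s * (1 / 4 - s) := max_eq_right (by nlinarith)
  rw [h1, pow_succ]
  have h2 : (s * (1 / 4 - s)) ^ n ≤ s ^ n := pow_le_pow_left₀ (by nlinarith) (by nlinarith) _
  have h3 : s * (1 / 4 - s) ≤ 1 := by nlinarith
  calc (s * (1 / 4 - s)) ^ n * (s * (1 / 4 - s)) ≤ s ^ n * 1 :=
        mul_le_mul h2 h3 (by nlinarith) (pow_nonneg hs.1.le _)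
    _ = s ^ n := mul_one _
/-- Auxiliary lemma `psiB_integral_pos` of the Bui–Hall sign-conjecture leg (Corollary signs (a) — all orders even ⇒ `M(k) > 0`, proved: `AllEvenPos`); statement as displayed, box port verbatim. [cite: BuiHall2023, §1 Conjecture 1 — a step of THIS TREE's proof of it (box write-up paper-v3-d979a68f Corollary signs (a) — all orders even ⇒ `M(k) > 0`; proved: `AllEvenPo); the cited paper states the conjecture and the proof is ours] -/
theorem psiB_integral_pos (n : ℕ) : 0 < ∫ s in (-1:ℝ)..1, psiB n s := by
  have h : ∫ s in (-1:ℝ)..1, (0:ℝ) < ∫ s in (-1:ℝ)..1, psiB n s := by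
    refine intervalIntegral.integral_lt_integral_of_continuousOn_of_le_of_exists_lt (by norm_num) continuousOn_const
      (psiB_continuous n).continuousOn (fun s _ => psiB_nonneg n s) ⟨1 / 8, ⟨by norm_num, by norm_num⟩, ?_⟩
    unfold psiB
    rw [max_eq_right (by norm_num)]
    apply pow_pos; norm_num
  simpa using h

variable (a b c d : ℕ)

/-- the integrand of `intQ` for the all-even monomial [folklore] -/
noncomputable def Gev (p q r : ℝ) : ℝ :=
  if |p + q + r| ≤ 1 then p ^ (2 * a) * q ^ (2 * b) * r ^ (2 * c) * (-p - q - r) ^ (2 * d) else 0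

/-- Auxiliary lemma `Gev_nonneg` of the Bui–Hall sign-conjecture leg (Corollary signs (a) — all orders even ⇒ `M(k) > 0`, proved: `AllEvenPos`); statement as displayed, box port verbatim. [cite: BuiHall2023, §1 Conjecture 1 — a step of THIS TREE's proof of it (box write-up paper-v3-d979a68f Corollary signs (a) — all orders even ⇒ `M(k) > 0`; proved: `AllEvenPo); the cited paper states the conjecture and the proof is ours] -/
theorem Gev_nonneg (p q r : ℝ) : 0 ≤ Gev a b c d p q r := by
  unfold Gev; split_ifs
  · have e : (-p - q - r) ^ (2 * d) = (p + q + r) ^ (2 * d) := by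
      rw [show -p - q - r = -(p + q + r) by ring, Even.neg_pow ⟨d, by ring⟩]
    rw [e]
    exact mul_nonneg (mul_nonneg (mul_nonneg ((even_two_mul a).pow_nonneg p) ((even_two_mul b).pow_nonneg q))
      ((even_two_mul c).pow_nonneg r)) ((even_two_mul d).pow_nonneg _)
  · exact le_rfl

/-- the separable continuous minorant [cite: BuiHall2023, §1 Conjecture 1 — a step of THIS TREE's proof of it (box write-up paper-v3-d979a68f Corollary signs (a) — all orders even ⇒ `M(k) > 0`; proved: `AllEvenPo); the cited paper states the conjecture and the proof is ours] -/
theorem minorant_le (p q r : ℝ) :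
    psiB (2 * a + 1) p * psiB (2 * b + 1) q * psiB (2 * c + 2 * d + 1) r ≤ Gev a b c d p q r := by
  by_cases hp : 0 < p ∧ p < 1 / 4
  · by_cases hq : 0 < q ∧ q < 1 / 4
    · by_cases hr : 0 < r ∧ r < 1 / 4
      · have hin : |p + q + r| ≤ 1 := by rw [abs_le]; constructor <;> linarith [hp.1, hq.1, hr.1, hp.2, hq.2, hr.2]
        unfold Gev; rw [if_pos hin]
        have e : (-p - q - r) ^ (2 * d) = (p + q + r) ^ (2 * d) := by
          rw [show -p - q - r = -(p + q + r) by ring, Even.neg_pow ⟨d, by ring⟩]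
        rw [e]
        have h1 := psiB_le_pow (n := 2 * a) hp
        have h2 := psiB_le_pow (n := 2 * b) hq
        have h3 := psiB_le_pow (n := 2 * c + 2 * d) hr
        have h4 : r ^ (2 * c + 2 * d) ≤ r ^ (2 * c) * (p + q + r) ^ (2 * d) := by
          rw [pow_add]
          apply mul_le_mul_of_nonneg_left _ (pow_nonneg hr.1.le _)
          exact pow_le_pow_left₀ hr.1.le (by linarith [hp.1, hq.1]) _
        calc psiB (2 * a + 1) p * psiB (2 * b + 1) q * psiB (2 * c + 2 * d + 1) r
            ≤ p ^ (2 * a) * q ^ (2 * b) * r ^ (2 * c + 2 * d) := by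
              apply mul_le_mul (mul_le_mul h1 h2 (psiB_nonneg _ _) (pow_nonneg hp.1.le _)) h3 (psiB_nonneg _ _)
              exact mul_nonneg (pow_nonneg hp.1.le _) (pow_nonneg hq.1.le _)
          _ ≤ p ^ (2 * a) * q ^ (2 * b) * (r ^ (2 * c) * (p + q + r) ^ (2 * d)) := by
              apply mul_le_mul_of_nonneg_left h4
              exact mul_nonneg (pow_nonneg hp.1.le _) (pow_nonneg hq.1.le _)
          _ = p ^ (2 * a) * q ^ (2 * b) * r ^ (2 * c) * (p + q + r) ^ (2 * d) := by ring
      · rw [psiB_eq_zero (by omega) hr, mul_zero]; exact Gev_nonneg a b c d p q r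
    · rw [psiB_eq_zero (by omega) hq, mul_zero, zero_mul]; exact Gev_nonneg a b c d p q r
  · rw [psiB_eq_zero (by omega) hp, zero_mul, zero_mul]; exact Gev_nonneg a b c d p q r

/-- joint measurability of the integrand [cite: BuiHall2023, §1 Conjecture 1 — a step of THIS TREE's proof of it (box write-up paper-v3-d979a68f Corollary signs (a) — all orders even ⇒ `M(k) > 0`; proved: `AllEvenPo); the cited paper states the conjecture and the proof is ours] -/
theorem Gev_measurable : Measurable (fun x : ℝ × ℝ × ℝ => Gev a b c d x.1 x.2.1 x.2.2) := by
  unfold Gev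
  apply Measurable.ite
  · exact measurableSet_le (by fun_prop) measurable_const
  · fun_prop
  · exact measurable_const

/-- bound `|G| ≤ 3^{2c}` for `|p|,|q| ≤ 1` (then `|r| ≤ 3` on the support) [cite: BuiHall2023, §1 Conjecture 1 — a step of THIS TREE's proof of it (box write-up paper-v3-d979a68f Corollary signs (a) — all orders even ⇒ `M(k) > 0`; proved: `AllEvenPo); the cited paper states the conjecture and the proof is ours] -/
theorem Gev_bound {p q : ℝ} (hp : |p| ≤ 1) (hq : |q| ≤ 1) (r : ℝ) : |Gev a b c d p q r| ≤ 3 ^ (2 * c) := by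
  unfold Gev; split_ifs with h
  · have hr : |r| ≤ 3 := by
      have := abs_le.mp h; have := abs_le.mp hp; have := abs_le.mp hq
      rw [abs_le]; constructor <;> linarith
    have hs : |-p - q - r| ≤ 1 := by rw [show -p - q - r = -(p + q + r) by ring, abs_neg]; exact h
    rw [abs_mul, abs_mul, abs_mul, abs_pow, abs_pow, abs_pow, abs_pow]
    calc |p| ^ (2 * a) * |q| ^ (2 * b) * |r| ^ (2 * c) * |-p - q - r| ^ (2 * d)
        ≤ 1 ^ (2 * a) * 1 ^ (2 * b) * 3 ^ (2 * c) * 1 ^ (2 * d) := by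
          gcongr
    _ = 3 ^ (2 * c) := by simp
  · simp

/-- a bounded measurable function is interval integrable [cite: BuiHall2023, §1 Conjecture 1 — a step of THIS TREE's proof of it (box write-up paper-v3-d979a68f Corollary signs (a) — all orders even ⇒ `M(k) > 0`; proved: `AllEvenPo); the cited paper states the conjecture and the proof is ours] -/
theorem intervalIntegrable_of_bdd {f : ℝ → ℝ} (hm : Measurable f) {C : ℝ} {a₁ b₁ : ℝ}
    (hb : ∀ x ∈ Set.uIoc a₁ b₁, |f x| ≤ C) : IntervalIntegrable f volume a₁ b₁ := by
  rw [intervalIntegrable_iff]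
  have hc : IntegrableOn (fun _ => C) (Set.uIoc a₁ b₁) volume :=
    integrableOn_const (by rw [Set.uIoc, Real.volume_Ioc]; exact ENNReal.ofReal_ne_top)
  refine hc.mono' hm.aestronglyMeasurable ?_
  rw [MeasureTheory.ae_restrict_iff' measurableSet_uIoc]
  exact Filter.Eventually.of_forall fun x hx => by rw [Real.norm_eq_abs]; exact hb x hx

/-- the inner integrals as integrals over `Ioc (-1) 1` (measurable in the parameters) [folklore] -/
noncomputable def L3ev (pq : ℝ × ℝ) : ℝ := ∫ r, Gev a b c d pq.1 pq.2 r ∂(volume.restrict (Ioc (-1) 1))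
/-- the middle layer `∫_{(-1,1]} L3ev(p,q) dq` of the iterated integral behind Corollary signs (a) [folklore] -/
noncomputable def L2ev (p : ℝ) : ℝ := ∫ q, L3ev a b c d (p, q) ∂(volume.restrict (Ioc (-1) 1))

/-- Auxiliary lemma `L3ev_stronglyMeasurable` of the Bui–Hall sign-conjecture leg (Corollary signs (a) — all orders even ⇒ `M(k) > 0`, proved: `AllEvenPos`); statement as displayed, box port verbatim. [cite: BuiHall2023, §1 Conjecture 1 — a step of THIS TREE's proof of it (box write-up paper-v3-d979a68f Corollary signs (a) — all orders even ⇒ `M(k) > 0`; proved: `AllEvenPo); the cited paper states the conjecture and the proof is ours] -/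
theorem L3ev_stronglyMeasurable : StronglyMeasurable (L3ev a b c d) := by
  unfold L3ev
  have hG : StronglyMeasurable (fun x : (ℝ × ℝ) × ℝ => Gev a b c d x.1.1 x.1.2 x.2) := by
    apply Measurable.stronglyMeasurable
    have e : (fun x : (ℝ × ℝ) × ℝ => Gev a b c d x.1.1 x.1.2 x.2)
        = (fun x : ℝ × ℝ × ℝ => Gev a b c d x.1 x.2.1 x.2.2) ∘ (fun x : (ℝ × ℝ) × ℝ => (x.1.1, x.1.2, x.2)) := rfl
    rw [e]; exact (Gev_measurable a b c d).comp (by fun_prop)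
  exact hG.integral_prod_right'

/-- Auxiliary lemma `L2ev_stronglyMeasurable` of the Bui–Hall sign-conjecture leg (Corollary signs (a) — all orders even ⇒ `M(k) > 0`, proved: `AllEvenPos`); statement as displayed, box port verbatim. [cite: BuiHall2023, §1 Conjecture 1 — a step of THIS TREE's proof of it (box write-up paper-v3-d979a68f Corollary signs (a) — all orders even ⇒ `M(k) > 0`; proved: `AllEvenPo); the cited paper states the conjecture and the proof is ours] -/
theorem L2ev_stronglyMeasurable : StronglyMeasurable (L2ev a b c d) := by
  unfold L2ev
  exact (L3ev_stronglyMeasurable a b c d).integral_prod_right'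

/-- Auxiliary lemma `L3ev_eq` of the Bui–Hall sign-conjecture leg (Corollary signs (a) — all orders even ⇒ `M(k) > 0`, proved: `AllEvenPos`); statement as displayed, box port verbatim. [cite: BuiHall2023, §1 Conjecture 1 — a step of THIS TREE's proof of it (box write-up paper-v3-d979a68f Corollary signs (a) — all orders even ⇒ `M(k) > 0`; proved: `AllEvenPo); the cited paper states the conjecture and the proof is ours] -/
theorem L3ev_eq (p q : ℝ) : ∫ r in (-1:ℝ)..1, Gev a b c d p q r = L3ev a b c d (p, q) := by
  rw [intervalIntegral.integral_of_le (by norm_num)]; rfl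

/-- Auxiliary lemma `L3ev_bound` of the Bui–Hall sign-conjecture leg (Corollary signs (a) — all orders even ⇒ `M(k) > 0`, proved: `AllEvenPos`); statement as displayed, box port verbatim. [cite: BuiHall2023, §1 Conjecture 1 — a step of THIS TREE's proof of it (box write-up paper-v3-d979a68f Corollary signs (a) — all orders even ⇒ `M(k) > 0`; proved: `AllEvenPo); the cited paper states the conjecture and the proof is ours] -/
theorem L3ev_bound {p q : ℝ} (hp : |p| ≤ 1) (hq : |q| ≤ 1) : |L3ev a b c d (p, q)| ≤ 3 ^ (2 * c) * 2 := by
  rw [← L3ev_eq]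
  have := intervalIntegral.norm_integral_le_of_norm_le_const (a := (-1:ℝ)) (b := 1) (C := (3:ℝ) ^ (2 * c))
    (f := fun r => Gev a b c d p q r) (fun r _ => by rw [Real.norm_eq_abs]; exact Gev_bound a b c d hp hq r)
  rw [Real.norm_eq_abs] at this
  norm_num at this
  linarith

/-- Auxiliary lemma `abs_le_one_of_mem_uIoc` of the Bui–Hall sign-conjecture leg (Corollary signs (a) — all orders even ⇒ `M(k) > 0`, proved: `AllEvenPos`); statement as displayed, box port verbatim. [cite: BuiHall2023, §1 Conjecture 1 — a step of THIS TREE's proof of it (box write-up paper-v3-d979a68f Corollary signs (a) — all orders even ⇒ `M(k) > 0`; proved: `AllEvenPo); the cited paper states the conjecture and the proof is ours] -/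
theorem abs_le_one_of_mem_uIoc {s : ℝ} (hs : s ∈ Set.uIoc (-1:ℝ) 1) : |s| ≤ 1 := by
  rw [Set.uIoc_of_le (by norm_num : (-1:ℝ) ≤ 1)] at hs
  rw [abs_le]; exact ⟨hs.1.le, hs.2⟩

/-- Auxiliary lemma `L3ev_intervalIntegrable` of the Bui–Hall sign-conjecture leg (Corollary signs (a) — all orders even ⇒ `M(k) > 0`, proved: `AllEvenPos`); statement as displayed, box port verbatim. [cite: BuiHall2023, §1 Conjecture 1 — a step of THIS TREE's proof of it (box write-up paper-v3-d979a68f Corollary signs (a) — all orders even ⇒ `M(k) > 0`; proved: `AllEvenPo); the cited paper states the conjecture and the proof is ours] -/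
theorem L3ev_intervalIntegrable {p : ℝ} (hp : |p| ≤ 1) :
    IntervalIntegrable (fun q => L3ev a b c d (p, q)) volume (-1) 1 := by
  refine intervalIntegrable_of_bdd (f := fun q => L3ev a b c d (p, q)) (C := 3 ^ (2 * c) * 2) ?_ (fun q hq => ?_)
  · exact (L3ev_stronglyMeasurable a b c d).measurable.comp (measurable_const.prodMk measurable_id)
  · exact L3ev_bound a b c d hp (abs_le_one_of_mem_uIoc hq)

/-- Auxiliary lemma `L2ev_eq` of the Bui–Hall sign-conjecture leg (Corollary signs (a) — all orders even ⇒ `M(k) > 0`, proved: `AllEvenPos`); statement as displayed, box port verbatim. [cite: BuiHall2023, §1 Conjecture 1 — a step of THIS TREE's proof of it (box write-up paper-v3-d979a68f Corollary signs (a) — all orders even ⇒ `M(k) > 0`; proved: `AllEvenPo); the cited paper states the conjecture and the proof is ours] -/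
theorem L2ev_eq (p : ℝ) : ∫ q in (-1:ℝ)..1, L3ev a b c d (p, q) = L2ev a b c d p := by
  rw [intervalIntegral.integral_of_le (by norm_num)]; rfl

/-- Auxiliary lemma `L2ev_intervalIntegrable` of the Bui–Hall sign-conjecture leg (Corollary signs (a) — all orders even ⇒ `M(k) > 0`, proved: `AllEvenPos`); statement as displayed, box port verbatim. [cite: BuiHall2023, §1 Conjecture 1 — a step of THIS TREE's proof of it (box write-up paper-v3-d979a68f Corollary signs (a) — all orders even ⇒ `M(k) > 0`; proved: `AllEvenPo); the cited paper states the conjecture and the proof is ours] -/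
theorem L2ev_intervalIntegrable : IntervalIntegrable (L2ev a b c d) volume (-1) 1 := by
  apply intervalIntegrable_of_bdd (L2ev_stronglyMeasurable a b c d).measurable (C := 3 ^ (2 * c) * 2 * 2)
  intro p hp
  rw [← L2ev_eq]
  have hp1 := abs_le_one_of_mem_uIoc hp
  have := intervalIntegral.norm_integral_le_of_norm_le_const (a := (-1:ℝ)) (b := 1) (C := (3:ℝ) ^ (2 * c) * 2)
    (f := fun q => L3ev a b c d (p, q)) (fun q hq => by
      rw [Real.norm_eq_abs]; exact L3ev_bound a b c d hp1 (abs_le_one_of_mem_uIoc hq))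
  rw [Real.norm_eq_abs] at this
  norm_num at this
  linarith

/-- **Corollary signs (a)**: `M(2a,2b,2c,2d) > 0`. [cite: BuiHall2023, §1 Conjecture 1 — a step of THIS TREE's proof of it (box write-up paper-v3-d979a68f Corollary signs (a) — all orders even ⇒ `M(k) > 0`; proved: `AllEvenPo); the cited paper states the conjecture and the proof is ours] -/
theorem allEvenPos_holds : AllEvenPos := by
  intro a b c d
  unfold M intQ
  show 0 < 3 / 16 * ∫ p in (-1:ℝ)..1, ∫ q in (-1:ℝ)..1, ∫ r in (-1:ℝ)..1, Gev a b c d p q r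
  set I1 := ∫ s in (-1:ℝ)..1, psiB (2 * a + 1) s
  set I2 := ∫ s in (-1:ℝ)..1, psiB (2 * b + 1) s
  set I3 := ∫ s in (-1:ℝ)..1, psiB (2 * c + 2 * d + 1) s
  have hI1 := psiB_integral_pos (2 * a + 1)
  have hI2 := psiB_integral_pos (2 * b + 1)
  have hI3 := psiB_integral_pos (2 * c + 2 * d + 1)
  -- level 3
  have lev3 : ∀ p q : ℝ, |p| ≤ 1 → |q| ≤ 1 →
      psiB (2 * a + 1) p * psiB (2 * b + 1) q * I3 ≤ ∫ r in (-1:ℝ)..1, Gev a b c d p q r := by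
    intro p q hp hq
    have e : psiB (2 * a + 1) p * psiB (2 * b + 1) q * I3
        = ∫ r in (-1:ℝ)..1, psiB (2 * a + 1) p * psiB (2 * b + 1) q * psiB (2 * c + 2 * d + 1) r := by
      rw [intervalIntegral.integral_const_mul]
    rw [e]
    apply intervalIntegral.integral_mono_on (by norm_num)
    · exact ((psiB_continuous _).const_mul _).intervalIntegrable _ _
    · have hm : Measurable (fun r => Gev a b c d p q r) :=
        (Gev_measurable a b c d).comp (measurable_const.prodMk (measurable_const.prodMk measurable_id))
      exact intervalIntegrable_of_bdd hm (fun r _ => Gev_bound a b c d hp hq r)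
    · intro r _; exact minorant_le a b c d p q r
  -- level 2
  have lev2 : ∀ p : ℝ, |p| ≤ 1 → psiB (2 * a + 1) p * I2 * I3 ≤ ∫ q in (-1:ℝ)..1, ∫ r in (-1:ℝ)..1, Gev a b c d p q r := by
    intro p hp
    have e : psiB (2 * a + 1) p * I2 * I3 = ∫ q in (-1:ℝ)..1, psiB (2 * a + 1) p * psiB (2 * b + 1) q * I3 := by
      rw [show psiB (2 * a + 1) p * I2 * I3 = (psiB (2 * a + 1) p * I3) * I2 by ring,
        ← intervalIntegral.integral_const_mul]
      apply intervalIntegral.integral_congr; intro q _; ring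
    rw [e]
    simp_rw [L3ev_eq]
    apply intervalIntegral.integral_mono_on (by norm_num)
    · exact (((psiB_continuous _).const_mul _).mul_const _).intervalIntegrable _ _
    · exact L3ev_intervalIntegrable a b c d hp
    · intro q hq; rw [← L3ev_eq]; exact lev3 p q hp (abs_le.mpr ⟨hq.1, hq.2⟩)
  -- level 1
  have lev1 : I1 * I2 * I3 ≤ ∫ p in (-1:ℝ)..1, ∫ q in (-1:ℝ)..1, ∫ r in (-1:ℝ)..1, Gev a b c d p q r := by
    have e : I1 * I2 * I3 = ∫ p in (-1:ℝ)..1, psiB (2 * a + 1) p * I2 * I3 := by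
      rw [show I1 * I2 * I3 = (I2 * I3) * I1 by ring, ← intervalIntegral.integral_const_mul]
      apply intervalIntegral.integral_congr; intro p _; ring
    rw [e]
    simp_rw [L3ev_eq, L2ev_eq]
    apply intervalIntegral.integral_mono_on (by norm_num)
    · exact (((psiB_continuous _).mul_const _).mul_const _).intervalIntegrable _ _
    · exact L2ev_intervalIntegrable a b c d
    · intro p hp
      rw [← L2ev_eq]; simp_rw [← L3ev_eq]
      exact lev2 p (abs_le.mpr ⟨hp.1, hp.2⟩)
  have : 0 < I1 * I2 * I3 := by positivity
  linarith

end alleven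


/-! ## Section 4.1: `Λ_{c,d}` (eq. (Lcd)), the implication `Λ_{c,d} ≤ 0` ⇒ (spade) (PROVED; the direction the paper uses),
and the mixture representation `Λ_{c,d} = ∬ Λ(u,v;r,r') dm_c(r) dm_d(r')` (with Lemma QI + eq. (prims) identifying `Λ(u,v;r,r')`
with the closed form `Lam`), stated as the named Prop `Mixture` and PROVED further below (`mixture_holds`, section mix2).
Hence Theorem master (PROVED) ⇒ `Λ_{c,d} ≤ 0` ⇒ (spade): `Reduction` (Proposition reduce's first clause) is the theorem
`reduction_of_mixture mixture_holds`, and the certificates are load-bearing for Theorem BH. -/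

section reduction

/-- `Λ_{c,d}(u,v) := ∫_{v-u}^{1-u} F_{c,d} + ∫_{u+v}^{1+u} F_{c,d}` (eq. (Lcd)), with `F_{c,d} = -h_{c,d}` on `[-2,2]` (Lemma C;
all four limits lie in `[-2,2]` when `0 ≤ v ≤ u ≤ 1`). [folklore] -/
noncomputable def LamCD (c d : ℕ) (u v : ℝ) : ℝ :=
  (∫ s in (v - u)..(1 - u), -hcd c d s) + ∫ s in (u + v)..(1 + u), -hcd c d s

/-- **The mixture representation** (tex 187–189 with Lemma QI, eq. (LamN), and eq. (prims)):
`f_c = ∫ f̃_r dm_c(r)`, `m_0 = δ_0`, `dm_c(r) = d(r^{2c}) = 2c r^{2c-1} dr` (`c ≥ 1`), hence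
`Λ_{c,d}(u,v) = ∬ Λ(u,v;r,r') dm_c(r) dm_d(r')` with `Λ(u,v;r,r') = Lam u v r r'` — stated in the four cases `c, d ∈ {0} ∪ ℕ_{≥1}`.
A named Prop, PROVED below (`mixture_holds`: exchanging the mixture with the window integrals, folding to `[r,1]×[r',1]`, and
the two polygon-measure primitives — sections prims, qi1, qi2, mix1, mix2). [cite: BuiHall2023, §1 Conj. 1 (the Bui–Hall sign law) is the statement PROVED through this intermediate Prop of the present tree (box write-up paper-v3-d979a68f Section 4.1: the mixture identity with Lemma 9 and eq. (prims)) — NOT a statement of the cited paper; discharged in these modules by the theorem of the same name with suffix _holds and never assumed] -/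
def Mixture : Prop :=
  (∀ u v : ℝ, 0 ≤ v → v ≤ u → u ≤ 1 → LamCD 0 0 u v = Lam u v 0 0) ∧
  (∀ c : ℕ, ∀ u v : ℝ, 0 ≤ v → v ≤ u → u ≤ 1 →
      LamCD (c + 1) 0 u v = ∫ r in (0:ℝ)..1, (2 * ((c:ℝ) + 1) * r ^ (2 * c + 1)) * Lam u v r 0) ∧
  (∀ d : ℕ, ∀ u v : ℝ, 0 ≤ v → v ≤ u → u ≤ 1 →
      LamCD 0 (d + 1) u v = ∫ r' in (0:ℝ)..1, (2 * ((d:ℝ) + 1) * r' ^ (2 * d + 1)) * Lam u v 0 r') ∧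
  (∀ c d : ℕ, ∀ u v : ℝ, 0 ≤ v → v ≤ u → u ≤ 1 →
      LamCD (c + 1) (d + 1) u v = ∫ r in (0:ℝ)..1,
        (2 * ((c:ℝ) + 1) * r ^ (2 * c + 1)) * ∫ r' in (0:ℝ)..1, (2 * ((d:ℝ) + 1) * r' ^ (2 * d + 1)) * Lam u v r r')

/-- Theorem master + the mixture ⇒ `Λ_{c,d} ≤ 0` on the triangle [cite: BuiHall2023, §1 Conjecture 1 — a step of THIS TREE's proof of it (box write-up paper-v3-d979a68f Section 4.1: `Λ_{cd}` (eq. (Lcd)); the implication `Λ_{cd} ≤ 0` ⇒ (s); the cited paper states the conjecture and the proof is ours] -/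
theorem lamCD_nonpos (hMix : Mixture) (hM : MasterIneq) (c d : ℕ) {u v : ℝ} (hv : 0 ≤ v) (hvu : v ≤ u) (hu : u ≤ 1) :
    LamCD c d u v ≤ 0 := by
  obtain ⟨m00, mc0, m0d, mcd⟩ := hMix
  have hL : ∀ r ∈ Icc (0:ℝ) 1, ∀ r' ∈ Icc (0:ℝ) 1, Lam u v r r' ≤ 0 :=
    fun r hr r' hr' => hM u v r r' ⟨hv, hvu, hu, hr.1, hr.2, hr'.1, hr'.2⟩
  have wnn : ∀ (n : ℕ) (r : ℝ), 0 ≤ r → 0 ≤ 2 * ((n:ℝ) + 1) * r ^ (2 * n + 1) := fun n r hr => by positivity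
  -- ∫ (weight × Lam) ≤ 0 on [0,1]
  have int1 : ∀ (n : ℕ) (g : ℝ → ℝ), (∀ r ∈ Icc (0:ℝ) 1, g r ≤ 0) →
      ∫ r in (0:ℝ)..1, (2 * ((n:ℝ) + 1) * r ^ (2 * n + 1)) * g r ≤ 0 := by
    intro n g hg
    have : 0 ≤ ∫ r in (0:ℝ)..1, -((2 * ((n:ℝ) + 1) * r ^ (2 * n + 1)) * g r) := by
      apply intervalIntegral.integral_nonneg zero_le_one
      intro r hr
      have := mul_nonpos_of_nonneg_of_nonpos (wnn n r hr.1) (hg r hr)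
      linarith
    rw [intervalIntegral.integral_neg] at this; linarith
  rcases c with _ | c <;> rcases d with _ | d
  · rw [m00 u v hv hvu hu]; exact hL 0 ⟨le_rfl, zero_le_one⟩ 0 ⟨le_rfl, zero_le_one⟩
  · rw [m0d d u v hv hvu hu]; exact int1 d _ (fun r' hr' => hL 0 ⟨le_rfl, zero_le_one⟩ r' hr')
  · rw [mc0 c u v hv hvu hu]; exact int1 c _ (fun r hr => hL r hr 0 ⟨le_rfl, zero_le_one⟩)
  · rw [mcd c d u v hv hvu hu]
    exact int1 c _ (fun r hr => int1 d _ (fun r' hr' => hL r hr r' hr'))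

/-- **Λ_{c,d} ≤ 0 ⇒ (spade)** (tex 183–186: "Since F is even, (spade) is equivalent to ∫_{u-v}^{u+v}F ≥ ∫_{u-1}^{u+1}F, i.e. to
Λ_{c,d}(u,v) ≤ 0") — the direction the paper uses, PROVED from the evenness and continuity of `h_{c,d}` (the converse is not
needed and not formalized) [cite: BuiHall2023, §1 Conjecture 1 — a step of THIS TREE's proof of it (box write-up paper-v3-d979a68f Section 4.1: `Λ_{cd}` (eq. (Lcd)); the implication `Λ_{cd} ≤ 0` ⇒ (s); the cited paper states the conjecture and the proof is ours] -/
theorem spade_of_lamCD_nonpos (c d : ℕ) (h : ∀ u v : ℝ, 0 ≤ v → v ≤ u → u ≤ 1 → LamCD c d u v ≤ 0) : Spade c d := by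
  intro u v hv hvu hu
  have hI : ∀ a b : ℝ, IntervalIntegrable (hcd c d) volume a b := fun a b => (hcd_continuous c d).intervalIntegrable a b
  have hLam := h u v hv hvu hu
  unfold LamCD at hLam
  rw [intervalIntegral.integral_neg, intervalIntegral.integral_neg] at hLam
  unfold Hcd
  -- H(1-u) = ∫_{u-1}^0 h  and  ∫_{u-1}^{u-v} h = ∫_{v-u}^{1-u} h  (h even)
  have ev1 : ∫ t in (0:ℝ)..(1 - u), hcd c d t = ∫ t in (u - 1)..0, hcd c d t := by
    have := intervalIntegral.integral_comp_neg (a := (0:ℝ)) (b := 1 - u) (fun t => hcd c d t)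
    simp only [hcd_even, neg_zero] at this
    rw [this, show -(1 - u) = u - 1 by ring]
  have ev2 : ∫ t in (u - 1)..(u - v), hcd c d t = ∫ t in (v - u)..(1 - u), hcd c d t := by
    have := intervalIntegral.integral_comp_neg (a := u - 1) (b := u - v) (fun t => hcd c d t)
    simp only [hcd_even] at this
    rw [this, show -(u - v) = v - u by ring, show -(u - 1) = 1 - u by ring]
  -- additivity
  have a1 : ∫ t in (0:ℝ)..(u + v), hcd c d t = (∫ t in (0:ℝ)..(u - v), hcd c d t) + ∫ t in (u - v)..(u + v), hcd c d t :=
    (intervalIntegral.integral_add_adjacent_intervals (hI _ _) (hI _ _)).symm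
  have a2 : ∫ t in (u - 1)..(1 + u), hcd c d t
      = (∫ t in (u - 1)..(u - v), hcd c d t) + ((∫ t in (u - v)..(u + v), hcd c d t) + ∫ t in (u + v)..(1 + u), hcd c d t) := by
    rw [intervalIntegral.integral_add_adjacent_intervals (hI _ _) (hI _ _),
      intervalIntegral.integral_add_adjacent_intervals (hI _ _) (hI _ _)]
  have a3 : ∫ t in (u - 1)..(1 + u), hcd c d t = (∫ t in (u - 1)..0, hcd c d t) + ∫ t in (0:ℝ)..(1 + u), hcd c d t :=
    (intervalIntegral.integral_add_adjacent_intervals (hI _ _) (hI _ _)).symm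
  rw [ev1]
  linarith [a1, a2, a3, ev2, hLam]

/-- Proposition reduce from the mixture: `Reduction` holds [cite: BuiHall2023, §1 Conjecture 1 — a step of THIS TREE's proof of it (box write-up paper-v3-d979a68f Section 4.1: `Λ_{cd}` (eq. (Lcd)); the implication `Λ_{cd} ≤ 0` ⇒ (s); the cited paper states the conjecture and the proof is ours] -/
theorem reduction_of_mixture (hMix : Mixture) : Reduction :=
  fun hM c d => spade_of_lamCD_nonpos c d (fun _ _ hv hvu hu => lamCD_nonpos hMix hM c d hv hvu hu)

end reduction


/-! ## The chart identity eq. (Tcd) — part 1: one-dimensional tools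
(window relocation under an indicator, and the inner line integral `= -h_{c,d}`) -/

section chart1

/-- moving a unit window: `∫_{d-1}^{d+1} 1[|s| ≤ 1] φ = ∫_{-1}^{1} 1[|s-d| ≤ 1] φ` [cite: BuiHall2023, §1 Conjecture 1 — a step of THIS TREE's proof of it (box write-up paper-v3-d979a68f The chart identity eq. (Tcd) — part 1: one-dimensional tools); the cited paper states the conjecture and the proof is ours] -/
theorem window_swap (φ : ℝ → ℝ) (d : ℝ) :
    ∫ s in (d - 1)..(d + 1), (if |s| ≤ 1 then φ s else 0) = ∫ s in (-1:ℝ)..1, (if |s - d| ≤ 1 then φ s else 0) := by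
  have e1 : (fun s => if |s| ≤ 1 then φ s else 0) = Set.indicator (Icc (-1) 1) φ := by
    ext s; simp only [Set.indicator_apply, mem_Icc, abs_le]
  have e2 : (fun s => if |s - d| ≤ 1 then φ s else 0) = Set.indicator (Icc (d - 1) (d + 1)) φ := by
    ext s; simp only [Set.indicator_apply, mem_Icc, abs_le]
    have : (-1 ≤ s - d ∧ s - d ≤ 1) ↔ (d - 1 ≤ s ∧ s ≤ d + 1) := by constructor <;> rintro ⟨h1, h2⟩ <;> constructor <;> linarith
    simp only [this]
  rw [e1, e2, intervalIntegral.integral_of_le (by linarith), intervalIntegral.integral_of_le (by norm_num),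
    setIntegral_indicator measurableSet_Icc, setIntegral_indicator measurableSet_Icc]
  apply setIntegral_congr_set
  have h1 : (Ioc (d - 1) (d + 1) ∩ Icc (-1) 1 : Set ℝ) =ᵐ[volume] (Icc (d - 1) (d + 1) ∩ Icc (-1) 1 : Set ℝ) :=
    (Ioc_ae_eq_Icc (μ := volume)).inter (ae_eq_refl _)
  have h2 : (Ioc (-1) 1 ∩ Icc (d - 1) (d + 1) : Set ℝ) =ᵐ[volume] (Icc (-1) 1 ∩ Icc (d - 1) (d + 1) : Set ℝ) :=
    (Ioc_ae_eq_Icc (μ := volume)).inter (ae_eq_refl _)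
  rw [Set.inter_comm (Icc (-1:ℝ) 1)] at h2
  exact h1.trans h2.symm

variable (c d : ℕ)

/-- the inner line integral of the chart: `J(t) = ∫_{-1}^{1} 1[|p - t| ≤ 1] p^{2c+1} (t-p)^{2d+1} dp` [folklore] -/
noncomputable def Jline (t : ℝ) : ℝ := ∫ p in (-1:ℝ)..1, (if |p - t| ≤ 1 then p ^ (2 * c + 1) * (t - p) ^ (2 * d + 1) else 0)

/-- `J(t) = -h_{c,d}(t)` for `0 ≤ t ≤ 2` [cite: BuiHall2023, §1 Conjecture 1 — a step of THIS TREE's proof of it (box write-up paper-v3-d979a68f The chart identity eq. (Tcd) — part 1: one-dimensional tools); the cited paper states the conjecture and the proof is ours] -/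
theorem Jline_eq_of_nonneg {t : ℝ} (ht0 : 0 ≤ t) (ht2 : t ≤ 2) : Jline c d t = -hcd c d t := by
  rw [hcd_eq_neg_Fcd c d ht0 ht2, neg_neg, Jline, ← window_swap, Fcd_eq]
  -- on [t-1, t+1] the indicator 1[|p| ≤ 1] is 1[p ≤ 1]
  have e : ∫ p in (t - 1)..(t + 1), (if |p| ≤ 1 then p ^ (2 * c + 1) * (t - p) ^ (2 * d + 1) else 0)
      = ∫ p in (t - 1)..(t + 1), Set.indicator {p | p ≤ 1} (fun p => p ^ (2 * c + 1) * (t - p) ^ (2 * d + 1)) p := by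
    apply intervalIntegral.integral_congr
    intro p hp
    rw [Set.uIcc_of_le (by linarith)] at hp
    simp only [Set.indicator_apply, mem_setOf_eq]
    have : |p| ≤ 1 ↔ p ≤ 1 := by
      rw [abs_le]; constructor
      · exact fun h => h.2
      · exact fun h => ⟨by linarith [hp.1], h⟩
    simp only [this]
  rw [e, intervalIntegral.integral_indicator (⟨by linarith, by linarith⟩ : (1:ℝ) ∈ Icc (t - 1) (t + 1))]
  rfl

/-- `J(t) = -h_{c,d}(t)` for `-2 ≤ t < 0` (evenness of `h` and the substitution `p ↦ -p`) [cite: BuiHall2023, §1 Conjecture 1 — a step of THIS TREE's proof of it (box write-up paper-v3-d979a68f The chart identity eq. (Tcd) — part 1: one-dimensional tools); the cited paper states the conjecture and the proof is ours] -/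
theorem Jline_eq_of_neg {t : ℝ} (ht0 : t < 0) (ht2 : -2 ≤ t) : Jline c d t = -hcd c d t := by
  rw [← hcd_even, hcd_eq_neg_Fcd c d (by linarith) (by linarith), neg_neg, Jline, ← window_swap, Fcd_eq]
  -- left: ∫_{t-1}^{t+1} 1[|p| ≤ 1] ψ = ∫_{-1}^{t+1} ψ  (lower cut at -1)
  have e : ∫ p in (t - 1)..(t + 1), (if |p| ≤ 1 then p ^ (2 * c + 1) * (t - p) ^ (2 * d + 1) else 0)
      = ∫ p in (t - 1)..(t + 1), Set.indicator (Ici (-1)) (fun p => p ^ (2 * c + 1) * (t - p) ^ (2 * d + 1)) p := by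
    apply intervalIntegral.integral_congr
    intro p hp
    rw [Set.uIcc_of_le (by linarith)] at hp
    simp only [Set.indicator_apply, mem_Ici]
    have : |p| ≤ 1 ↔ -1 ≤ p := by
      rw [abs_le]; constructor
      · exact fun h => h.1
      · exact fun h => ⟨h, by linarith [hp.2]⟩
    simp only [this]
  rw [e, integral_indicator_Ici (⟨by linarith, by linarith⟩ : (-1:ℝ) ∈ Icc (t - 1) (t + 1))]
  -- right: ∫_{-t-1}^{1} p^{2c+1} (-t-p)^{2d+1} dp = ∫_{-1}^{t+1} p^{2c+1} (t-p)^{2d+1} dp  (p ↦ -p)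
  simp only [gF]
  have := intervalIntegral.integral_comp_neg (a := -t - 1) (b := (1:ℝ))
    (fun p => p ^ (2 * c + 1) * (t - p) ^ (2 * d + 1))
  rw [show -(1:ℝ) = -1 from rfl, show -(-t - 1) = t + 1 by ring] at this
  rw [← this]
  apply intervalIntegral.integral_congr; intro p _
  simp only
  rw [show t - -p = -(-t - p) by ring, Odd.neg_pow (odd_two_mul_add_one c), Odd.neg_pow (odd_two_mul_add_one d)]
  ring

/-- Auxiliary lemma `Jline_eq` of the Bui–Hall sign-conjecture leg (The chart identity eq. (Tcd) — part 1: one-dimensional tools); statement as displayed, box port verbatim. [cite: BuiHall2023, §1 Conjecture 1 — a step of THIS TREE's proof of it (box write-up paper-v3-d979a68f The chart identity eq. (Tcd) — part 1: one-dimensional tools); the cited paper states the conjecture and the proof is ours] -/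
theorem Jline_eq {t : ℝ} (ht : |t| ≤ 2) : Jline c d t = -hcd c d t := by
  rcases le_or_gt 0 t with h | h
  · exact Jline_eq_of_nonneg c d h (abs_le.mp ht).2
  · exact Jline_eq_of_neg c d h (abs_le.mp ht).1

end chart1


/-! ## The chart identity eq. (Tcd) — part 2: the `(u₃,u₄,u₁)`-chart on `∫_Q`, proved: `ChartIdentity` -/

section chart2
variable (c d k₃ k₄ : ℕ)

/-- the `∫_Q` integrand for `k = (2c+1, 2d+1, k₃, k₄)` and its two relocated forms [folklore] -/
noncomputable def G0 (p q r : ℝ) : ℝ :=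
  if |p + q + r| ≤ 1 then p ^ (2 * c + 1) * q ^ (2 * d + 1) * r ^ k₃ * (-p - q - r) ^ k₄ else 0
/-- the integrand after the first substitution of the `(u₃,u₄,u₁)`-chart computation (eq. (Tcd), step S1) [folklore] -/
noncomputable def G1 (p q s : ℝ) : ℝ :=
  if |p + q + s| ≤ 1 then p ^ (2 * c + 1) * q ^ (2 * d + 1) * (-p - q - s) ^ k₃ * s ^ k₄ else 0
/-- the integrand after the second substitution of the chart computation (eq. (Tcd), step S3) [folklore] -/
noncomputable def G2 (p s w : ℝ) : ℝ :=
  if |p + s + w| ≤ 1 then p ^ (2 * c + 1) * (-p - s - w) ^ (2 * d + 1) * w ^ k₃ * s ^ k₄ else 0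

/-- step 1: `r ↦ s = -p-q-r` in the innermost integral [cite: BuiHall2023, §1 Conjecture 1 — a step of THIS TREE's proof of it (box write-up paper-v3-d979a68f The chart identity eq. (Tcd) — part 2: the `(u₃;u₄;u₁)`-chart on `∫_Q`); the cited paper states the conjecture and the proof is ours] -/
theorem chart_S1 (p q : ℝ) : ∫ r in (-1:ℝ)..1, G0 c d k₃ k₄ p q r = ∫ s in (-1:ℝ)..1, G1 c d k₃ k₄ p q s := by
  set dd := -p - q with hdd
  set g : ℝ → ℝ := fun s => if |s| ≤ 1 then p ^ (2 * c + 1) * q ^ (2 * d + 1) * (dd - s) ^ k₃ * s ^ k₄ else 0 with hg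
  have e1 : ∀ r, G0 c d k₃ k₄ p q r = g (dd - r) := by
    intro r
    simp only [hg, G0]
    have habs : |dd - r| = |p + q + r| := by rw [hdd, show -p - q - r = -(p + q + r) by ring, abs_neg]
    rw [habs, sub_sub_cancel]
  simp_rw [e1]
  rw [intervalIntegral.integral_comp_sub_left (fun s => g s) dd, show dd - 1 = dd - 1 from rfl,
    show dd - -1 = dd + 1 by ring, hg, window_swap]
  apply intervalIntegral.integral_congr; intro s _
  simp only [G1]
  have habs : |s - dd| = |p + q + s| := by rw [hdd]; ring_nf
  rw [habs, hdd]

/-- step 3: `q ↦ w = -p-s-q` [cite: BuiHall2023, §1 Conjecture 1 — a step of THIS TREE's proof of it (box write-up paper-v3-d979a68f The chart identity eq. (Tcd) — part 2: the `(u₃;u₄;u₁)`-chart on `∫_Q`); the cited paper states the conjecture and the proof is ours] -/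
theorem chart_S3 (p s : ℝ) : ∫ q in (-1:ℝ)..1, G1 c d k₃ k₄ p q s = ∫ w in (-1:ℝ)..1, G2 c d k₃ k₄ p s w := by
  set dd := -p - s with hdd
  set g : ℝ → ℝ := fun w => if |w| ≤ 1 then p ^ (2 * c + 1) * (dd - w) ^ (2 * d + 1) * w ^ k₃ * s ^ k₄ else 0 with hg
  have e1 : ∀ q, G1 c d k₃ k₄ p q s = g (dd - q) := by
    intro q
    simp only [hg, G1]
    have habs : |dd - q| = |p + q + s| := by rw [hdd, show -p - s - q = -(p + q + s) by ring, abs_neg]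
    rw [habs, sub_sub_cancel, hdd]
    split_ifs <;> ring
  simp_rw [e1]
  rw [intervalIntegral.integral_comp_sub_left (fun w => g w) dd, show dd - -1 = dd + 1 by ring, hg, window_swap]
  apply intervalIntegral.integral_congr; intro w _
  simp only [G2]
  have habs : |w - dd| = |p + s + w| := by rw [hdd]; ring_nf
  rw [habs, hdd]

/-- integrability of an indicator-times-polynomial integrand on a bounded rectangle [cite: BuiHall2023, §1 Conjecture 1 — a step of THIS TREE's proof of it (box write-up paper-v3-d979a68f The chart identity eq. (Tcd) — part 2: the `(u₃;u₄;u₁)`-chart on `∫_Q`); the cited paper states the conjecture and the proof is ours] -/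
theorem integrableOn_ite_rect {P : ℝ × ℝ → Prop} [DecidablePred P] (hP : MeasurableSet {x | P x}) {f : ℝ × ℝ → ℝ}
    (hf : Continuous f) : IntegrableOn (fun x => if P x then f x else 0) (Set.uIoc (-1:ℝ) 1 ×ˢ Set.uIoc (-1:ℝ) 1) := by
  have heq : (fun x => if P x then f x else 0) = Set.indicator {x | P x} f := by
    ext x; simp only [Set.indicator_apply, mem_setOf_eq]
  rw [heq]
  apply IntegrableOn.indicator _ hP
  have hK : IsCompact (Icc (-1:ℝ) 1 ×ˢ Icc (-1:ℝ) 1) := isCompact_Icc.prod isCompact_Icc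
  apply (hf.continuousOn.integrableOn_compact hK).mono_set
  rw [Set.uIoc_of_le (by norm_num : (-1:ℝ) ≤ 1)]
  exact Set.prod_mono Ioc_subset_Icc_self Ioc_subset_Icc_self

/-- step 2: swap `(q, s)` [cite: BuiHall2023, §1 Conjecture 1 — a step of THIS TREE's proof of it (box write-up paper-v3-d979a68f The chart identity eq. (Tcd) — part 2: the `(u₃;u₄;u₁)`-chart on `∫_Q`); the cited paper states the conjecture and the proof is ours] -/
theorem chart_S2 (p : ℝ) : ∫ q in (-1:ℝ)..1, ∫ s in (-1:ℝ)..1, G1 c d k₃ k₄ p q s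
    = ∫ s in (-1:ℝ)..1, ∫ q in (-1:ℝ)..1, G1 c d k₃ k₄ p q s := by
  apply MeasureTheory.intervalIntegral_intervalIntegral_swap
  have : Function.uncurry (fun q s => G1 c d k₃ k₄ p q s)
      = fun x : ℝ × ℝ => if |p + x.1 + x.2| ≤ 1 then
          p ^ (2 * c + 1) * x.1 ^ (2 * d + 1) * (-p - x.1 - x.2) ^ k₃ * x.2 ^ k₄ else 0 := by
    ext ⟨q, s⟩; rfl
  rw [this]
  exact integrableOn_ite_rect (measurableSet_le (by fun_prop) measurable_const) (by fun_prop)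

/-- step 5: swap `(p, w)` for fixed `s` [cite: BuiHall2023, §1 Conjecture 1 — a step of THIS TREE's proof of it (box write-up paper-v3-d979a68f The chart identity eq. (Tcd) — part 2: the `(u₃;u₄;u₁)`-chart on `∫_Q`); the cited paper states the conjecture and the proof is ours] -/
theorem chart_S5 (s : ℝ) : ∫ p in (-1:ℝ)..1, ∫ w in (-1:ℝ)..1, G2 c d k₃ k₄ p s w
    = ∫ w in (-1:ℝ)..1, ∫ p in (-1:ℝ)..1, G2 c d k₃ k₄ p s w := by
  apply MeasureTheory.intervalIntegral_intervalIntegral_swap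
  have : Function.uncurry (fun p w => G2 c d k₃ k₄ p s w)
      = fun x : ℝ × ℝ => if |x.1 + s + x.2| ≤ 1 then
          x.1 ^ (2 * c + 1) * (-x.1 - s - x.2) ^ (2 * d + 1) * x.2 ^ k₃ * s ^ k₄ else 0 := by
    ext ⟨p, w⟩; rfl
  rw [this]
  exact integrableOn_ite_rect (measurableSet_le (by fun_prop) measurable_const) (by fun_prop)

/-- `|G2| ≤ 1` for `|p|, |s| ≤ 1` and `w ∈ (-1,1]` [cite: BuiHall2023, §1 Conjecture 1 — a step of THIS TREE's proof of it (box write-up paper-v3-d979a68f The chart identity eq. (Tcd) — part 2: the `(u₃;u₄;u₁)`-chart on `∫_Q`); the cited paper states the conjecture and the proof is ours] -/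
theorem G2_bound {p s w : ℝ} (hp : |p| ≤ 1) (hs : |s| ≤ 1) (hw : |w| ≤ 1) : |G2 c d k₃ k₄ p s w| ≤ 1 := by
  unfold G2; split_ifs with h
  · have h2 : |-p - s - w| ≤ 1 := by rw [show -p - s - w = -(p + s + w) by ring, abs_neg]; exact h
    rw [abs_mul, abs_mul, abs_mul, abs_pow, abs_pow, abs_pow, abs_pow]
    calc |p| ^ (2 * c + 1) * |-p - s - w| ^ (2 * d + 1) * |w| ^ k₃ * |s| ^ k₄ ≤ 1 ^ (2 * c + 1) * 1 ^ (2 * d + 1) * 1 ^ k₃ * 1 ^ k₄ := by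
          gcongr
      _ = 1 := by simp
  · simp

/-- step 4: swap `(p, s)` past the inner `w`-integral [cite: BuiHall2023, §1 Conjecture 1 — a step of THIS TREE's proof of it (box write-up paper-v3-d979a68f The chart identity eq. (Tcd) — part 2: the `(u₃;u₄;u₁)`-chart on `∫_Q`); the cited paper states the conjecture and the proof is ours] -/
theorem chart_S4 : ∫ p in (-1:ℝ)..1, ∫ s in (-1:ℝ)..1, ∫ w in (-1:ℝ)..1, G2 c d k₃ k₄ p s w
    = ∫ s in (-1:ℝ)..1, ∫ p in (-1:ℝ)..1, ∫ w in (-1:ℝ)..1, G2 c d k₃ k₄ p s w := by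
  apply MeasureTheory.intervalIntegral_intervalIntegral_swap
  -- the inner integral as an integral over Ioc (-1) 1, measurable in (p,s)
  set F : ℝ × ℝ → ℝ := fun x => ∫ w, G2 c d k₃ k₄ x.1 x.2 w ∂(volume.restrict (Ioc (-1) 1)) with hF
  have hFeq : Function.uncurry (fun p s => ∫ w in (-1:ℝ)..1, G2 c d k₃ k₄ p s w) = F := by
    ext ⟨p, s⟩; simp only [Function.uncurry, hF]; rw [intervalIntegral.integral_of_le (by norm_num)]
  rw [hFeq]
  have hGm : Measurable (fun x : (ℝ × ℝ) × ℝ => G2 c d k₃ k₄ x.1.1 x.1.2 x.2) := by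
    unfold G2
    apply Measurable.ite
    · exact measurableSet_le (by fun_prop) measurable_const
    · fun_prop
    · exact measurable_const
  have hFm : StronglyMeasurable F := hGm.stronglyMeasurable.integral_prod_right'
  have hR : MeasurableSet (Set.uIoc (-1:ℝ) 1 ×ˢ Set.uIoc (-1:ℝ) 1) := measurableSet_uIoc.prod measurableSet_uIoc
  have hvol : volume (Set.uIoc (-1:ℝ) 1 ×ˢ Set.uIoc (-1:ℝ) 1) ≠ ⊤ := by
    rw [Measure.volume_eq_prod, Measure.prod_prod, Set.uIoc_of_le (by norm_num : (-1:ℝ) ≤ 1), Real.volume_Ioc]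
    exact ENNReal.mul_ne_top ENNReal.ofReal_ne_top ENNReal.ofReal_ne_top
  have hc : IntegrableOn (fun _ => (2:ℝ)) (Set.uIoc (-1:ℝ) 1 ×ˢ Set.uIoc (-1:ℝ) 1) := integrableOn_const hvol
  refine hc.mono' hFm.aestronglyMeasurable ?_
  rw [MeasureTheory.ae_restrict_iff' hR]
  refine Filter.Eventually.of_forall fun x hx => ?_
  obtain ⟨hp, hs⟩ := hx
  have hp1 := abs_le_one_of_mem_uIoc hp
  have hs1 := abs_le_one_of_mem_uIoc hs
  simp only [hF]
  rw [← intervalIntegral.integral_of_le (by norm_num : (-1:ℝ) ≤ 1)]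
  have := intervalIntegral.norm_integral_le_of_norm_le_const (a := (-1:ℝ)) (b := 1) (C := (1:ℝ))
    (f := fun w => G2 c d k₃ k₄ x.1 x.2 w) (fun w hw => by
      rw [Real.norm_eq_abs]; exact G2_bound c d k₃ k₄ hp1 hs1 (abs_le_one_of_mem_uIoc hw))
  norm_num at this
  exact this

/-- step 6: the innermost `p`-integral is `-w^{k₃} s^{k₄} h_{c,d}(s+w)` [cite: BuiHall2023, §1 Conjecture 1 — a step of THIS TREE's proof of it (box write-up paper-v3-d979a68f The chart identity eq. (Tcd) — part 2: the `(u₃;u₄;u₁)`-chart on `∫_Q`); the cited paper states the conjecture and the proof is ours] -/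
theorem chart_S6 {s w : ℝ} (hs : |s| ≤ 1) (hw : |w| ≤ 1) :
    ∫ p in (-1:ℝ)..1, G2 c d k₃ k₄ p s w = -(w ^ k₃ * s ^ k₄ * hcd c d (s + w)) := by
  set t := -(s + w) with ht
  have e : ∀ p, G2 c d k₃ k₄ p s w
      = (w ^ k₃ * s ^ k₄) * (if |p - t| ≤ 1 then p ^ (2 * c + 1) * (t - p) ^ (2 * d + 1) else 0) := by
    intro p
    simp only [G2]
    have h1 : |p + s + w| = |p - t| := by rw [ht]; ring_nf
    have h2 : -p - s - w = t - p := by rw [ht]; ring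
    rw [h1, h2]
    split_ifs <;> ring
  simp_rw [e]
  rw [intervalIntegral.integral_const_mul]
  have hJ := Jline_eq c d (t := t) (by
    rw [ht, abs_neg]; calc |s + w| ≤ |s| + |w| := abs_add_le _ _
      _ ≤ 2 := by linarith)
  unfold Jline at hJ
  rw [hJ, ht, hcd_even]
  ring

/-- the chart identity for general `k₃, k₄`: `M(2c+1, 2d+1, k₃, k₄) = -(3/16) ∫∫ u^{k₃} v^{k₄} h_{c,d}(u+v)` [cite: BuiHall2023, §1 Conjecture 1 — a step of THIS TREE's proof of it (box write-up paper-v3-d979a68f The chart identity eq. (Tcd) — part 2: the `(u₃;u₄;u₁)`-chart on `∫_Q`); the cited paper states the conjecture and the proof is ours] -/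
theorem chart_general : M (2 * c + 1) (2 * d + 1) k₃ k₄ = -(3 / 16) * Tint c d k₃ k₄ := by
  unfold M intQ Tint
  have step0 : (∫ p in (-1:ℝ)..1, ∫ q in (-1:ℝ)..1, ∫ r in (-1:ℝ)..1,
      (if |p + q + r| ≤ 1 then (fun a b e f : ℝ => a ^ (2 * c + 1) * b ^ (2 * d + 1) * e ^ k₃ * f ^ k₄) p q r (-p - q - r)
        else 0)) = ∫ p in (-1:ℝ)..1, ∫ q in (-1:ℝ)..1, ∫ r in (-1:ℝ)..1, G0 c d k₃ k₄ p q r := by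
    rfl
  rw [step0]
  have step1 : (∫ p in (-1:ℝ)..1, ∫ q in (-1:ℝ)..1, ∫ r in (-1:ℝ)..1, G0 c d k₃ k₄ p q r)
      = ∫ p in (-1:ℝ)..1, ∫ s in (-1:ℝ)..1, ∫ w in (-1:ℝ)..1, G2 c d k₃ k₄ p s w := by
    apply intervalIntegral.integral_congr; intro p _
    simp only
    simp_rw [chart_S1]
    rw [chart_S2]
    apply intervalIntegral.integral_congr; intro s _
    exact chart_S3 c d k₃ k₄ p s
  rw [step1, chart_S4]
  have step2 : (∫ s in (-1:ℝ)..1, ∫ p in (-1:ℝ)..1, ∫ w in (-1:ℝ)..1, G2 c d k₃ k₄ p s w)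
      = ∫ s in (-1:ℝ)..1, ∫ w in (-1:ℝ)..1, -(w ^ k₃ * s ^ k₄ * hcd c d (s + w)) := by
    apply intervalIntegral.integral_congr; intro s hs
    rw [Set.uIcc_of_le (by norm_num)] at hs
    simp only
    rw [chart_S5]
    apply intervalIntegral.integral_congr; intro w hw
    rw [Set.uIcc_of_le (by norm_num)] at hw
    exact chart_S6 c d k₃ k₄ (abs_le.mpr ⟨hs.1, hs.2⟩) (abs_le.mpr ⟨hw.1, hw.2⟩)
  rw [step2]
  simp_rw [intervalIntegral.integral_neg]
  -- swap the last two (continuous integrand) and rename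
  have hcont := hcd_continuous c d
  have step3 : (∫ s in (-1:ℝ)..1, ∫ w in (-1:ℝ)..1, w ^ k₃ * s ^ k₄ * hcd c d (s + w))
      = ∫ u in (-1:ℝ)..1, ∫ v in (-1:ℝ)..1, u ^ k₃ * v ^ k₄ * hcd c d (u + v) := by
    rw [MeasureTheory.intervalIntegral_intervalIntegral_swap]
    · apply intervalIntegral.integral_congr; intro u _
      apply intervalIntegral.integral_congr; intro v _
      simp only; rw [add_comm v u]
    · have hf : Continuous (Function.uncurry fun s w : ℝ => w ^ k₃ * s ^ k₄ * hcd c d (s + w)) := by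
        unfold Function.uncurry; fun_prop
      have hK : IsCompact (Icc (-1:ℝ) 1 ×ˢ Icc (-1:ℝ) 1) := isCompact_Icc.prod isCompact_Icc
      apply (hf.continuousOn.integrableOn_compact hK).mono_set
      rw [Set.uIoc_of_le (by norm_num : (-1:ℝ) ≤ 1)]
      exact Set.prod_mono Ioc_subset_Icc_self Ioc_subset_Icc_self
  rw [step3]
  ring

/-- **The chart identity** (eq. (Tcd) and its odd analogue), proved [cite: BuiHall2023, §1 Conjecture 1 — a step of THIS TREE's proof of it (box write-up paper-v3-d979a68f The chart identity eq. (Tcd) — part 2: the `(u₃;u₄;u₁)`-chart on `∫_Q`); the cited paper states the conjecture and the proof is ours] -/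
theorem chartIdentity_holds : ChartIdentity :=
  ⟨fun c d a b => chart_general c d (2 * a) (2 * b), fun c d a b => chart_general c d (2 * a + 1) (2 * b + 1)⟩

end chart2


/-! ## Proposition `11family` (= Prop. 6) — part 1: the fold, `S̃⁰ ≥ 0` from (spade), `S̃⁰(0,0) > 0` from (i) -/

section eleven1
variable (c d : ℕ)

/-- `q(u,v) = h(u+v) + h(|u-v|)` [folklore] -/
noncomputable def qK (u v : ℝ) : ℝ := hcd c d (u + v) + hcd c d |u - v|

/-- Auxiliary lemma `qK_continuous` of the Bui–Hall sign-conjecture leg (Proposition `11family` (= Prop. 6) — part 1: the fold, `S̃⁰ ≥ 0` from (spade), `S̃⁰(0,0) > 0` from (i)); statement as displayed, box port verbatim. [cite: BuiHall2023, §1 Conjecture 1 — a step of THIS TREE's proof of it (box write-up paper-v3-d979a68f Proposition `11family` (= Prop. 6) — part 1: the fold; `S̃⁰ ≥ 0` from ); the cited paper states the conjecture and the proof is ours] -/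
theorem qK_continuous : Continuous (Function.uncurry (qK c d)) := by
  have := hcd_continuous c d
  unfold qK Function.uncurry; fun_prop

/-- Auxiliary lemma `qK_symm` of the Bui–Hall sign-conjecture leg (Proposition `11family` (= Prop. 6) — part 1: the fold, `S̃⁰ ≥ 0` from (spade), `S̃⁰(0,0) > 0` from (i)); statement as displayed, box port verbatim. [cite: BuiHall2023, §1 Conjecture 1 — a step of THIS TREE's proof of it (box write-up paper-v3-d979a68f Proposition `11family` (= Prop. 6) — part 1: the fold; `S̃⁰ ≥ 0` from ); the cited paper states the conjecture and the proof is ours] -/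
theorem qK_symm (u v : ℝ) : qK c d u v = qK c d v u := by
  unfold qK; rw [add_comm u v, abs_sub_comm]

/-- `g_y(x) := ∫_y^1 q(x,v) dv` and `S̃⁰(x,y) := ∫_x^1 g_y(u) du = ∫_x^1 ∫_y^1 q` [folklore] -/
noncomputable def gInner (y x : ℝ) : ℝ := ∫ v in y..1, qK c d x v
/-- `S⁰(x,y) := ∫_x^1 ∫_y^1 q_K(u,v) dv du`, the folded double integral of Proposition 11family's proof [folklore] -/
noncomputable def S0 (x y : ℝ) : ℝ := ∫ u in x..1, gInner c d y u

/-- Auxiliary lemma `gInner_continuous` of the Bui–Hall sign-conjecture leg (Proposition `11family` (= Prop. 6) — part 1: the fold, `S̃⁰ ≥ 0` from (spade), `S̃⁰(0,0) > 0` from (i)); statement as displayed, box port verbatim. [cite: BuiHall2023, §1 Conjecture 1 — a step of THIS TREE's proof of it (box write-up paper-v3-d979a68f Proposition `11family` (= Prop. 6) — part 1: the fold; `S̃⁰ ≥ 0` from ); the cited paper states the conjecture and the proof is ours] -/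
theorem gInner_continuous : Continuous (Function.uncurry (gInner c d)) := by
  -- (y,x) ↦ ∫_y^1 q(x,v) dv = -∫_1^y q(x,v) dv
  have hf : Continuous (Function.uncurry fun (p : ℝ × ℝ) (v : ℝ) => qK c d p.2 v) := by
    have := qK_continuous c d
    exact this.comp (by fun_prop : Continuous fun z : (ℝ × ℝ) × ℝ => (z.1.2, z.2))
  have h := intervalIntegral.continuous_parametric_intervalIntegral_of_continuous (μ := volume) (a₀ := (1:ℝ)) hf
    (s := fun p : ℝ × ℝ => p.1) continuous_fst
  have e : Function.uncurry (gInner c d) = fun p : ℝ × ℝ => -∫ v in (1:ℝ)..p.1, qK c d p.2 v := by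
    ext ⟨y, x⟩; simp only [Function.uncurry, gInner]; rw [intervalIntegral.integral_symm]
  rw [e]; exact h.neg

/-- Auxiliary lemma `S0_continuous` of the Bui–Hall sign-conjecture leg (Proposition `11family` (= Prop. 6) — part 1: the fold, `S̃⁰ ≥ 0` from (spade), `S̃⁰(0,0) > 0` from (i)); statement as displayed, box port verbatim. [cite: BuiHall2023, §1 Conjecture 1 — a step of THIS TREE's proof of it (box write-up paper-v3-d979a68f Proposition `11family` (= Prop. 6) — part 1: the fold; `S̃⁰ ≥ 0` from ); the cited paper states the conjecture and the proof is ours] -/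
theorem S0_continuous : Continuous (Function.uncurry (S0 c d)) := by
  have hf : Continuous (Function.uncurry fun (p : ℝ × ℝ) (u : ℝ) => gInner c d p.2 u) := by
    have := gInner_continuous c d
    exact this.comp (by fun_prop : Continuous fun z : (ℝ × ℝ) × ℝ => (z.1.2, z.2))
  have h := intervalIntegral.continuous_parametric_intervalIntegral_of_continuous (μ := volume) (a₀ := (1:ℝ)) hf
    (s := fun p : ℝ × ℝ => p.1) continuous_fst
  have e : Function.uncurry (S0 c d) = fun p : ℝ × ℝ => -∫ u in (1:ℝ)..p.1, gInner c d p.2 u := by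
    ext ⟨x, y⟩; simp only [Function.uncurry, S0]; rw [intervalIntegral.integral_symm]
  rw [e]; exact h.neg

/-- `g_y(x) = H(1+x) - H(x+y) + H(x-y) + H(1-x)` on the triangle `0 ≤ y ≤ x ≤ 1` [cite: BuiHall2023, §1 Conjecture 1 — a step of THIS TREE's proof of it (box write-up paper-v3-d979a68f Proposition `11family` (= Prop. 6) — part 1: the fold; `S̃⁰ ≥ 0` from ); the cited paper states the conjecture and the proof is ours] -/
theorem gInner_formula {x y : ℝ} (hy : 0 ≤ y) (hyx : y ≤ x) (hx : x ≤ 1) :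
    gInner c d y x = Hcd c d (1 + x) - Hcd c d (x + y) + Hcd c d (x - y) + Hcd c d (1 - x) := by
  have hI : ∀ a b : ℝ, IntervalIntegrable (hcd c d) volume a b := fun a b => (hcd_continuous c d).intervalIntegrable a b
  unfold gInner qK Hcd
  have hcont := hcd_continuous c d
  have hA : IntervalIntegrable (fun v => hcd c d (x + v)) volume y 1 := by
    apply Continuous.intervalIntegrable; exact hcont.comp (continuous_const.add continuous_id)
  have hB : IntervalIntegrable (fun v => hcd c d |x - v|) volume y 1 := by
    apply Continuous.intervalIntegrable; exact hcont.comp (continuous_const.sub continuous_id).abs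
  rw [intervalIntegral.integral_add hA hB]
  -- first: ∫_y^1 h(x+v) dv = ∫_{x+y}^{x+1} h
  have e1 : ∫ v in y..1, hcd c d (x + v) = (∫ t in (0:ℝ)..(1 + x), hcd c d t) - ∫ t in (0:ℝ)..(x + y), hcd c d t := by
    rw [intervalIntegral.integral_comp_add_left (fun t => hcd c d t) x, add_comm x 1,
      intervalIntegral.integral_interval_sub_left (hI _ _) (hI _ _)]
  -- second: split at v = x
  have e2 : ∫ v in y..1, hcd c d |x - v| = (∫ t in (0:ℝ)..(x - y), hcd c d t) + ∫ t in (0:ℝ)..(1 - x), hcd c d t := by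
    have hJ : ∀ a b : ℝ, IntervalIntegrable (fun v => hcd c d |x - v|) volume a b := fun a b => by
      apply Continuous.intervalIntegrable; exact hcont.comp (continuous_const.sub continuous_id).abs
    rw [← intervalIntegral.integral_add_adjacent_intervals (hJ y x) (hJ x 1)]
    have p1 : ∫ v in y..x, hcd c d |x - v| = ∫ v in y..x, hcd c d (x - v) := by
      apply intervalIntegral.integral_congr; intro v hv
      rw [Set.uIcc_of_le hyx] at hv; simp only; rw [abs_of_nonneg (by linarith [hv.2])]
    have p2 : ∫ v in x..1, hcd c d |x - v| = ∫ v in x..1, hcd c d (v - x) := by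
      apply intervalIntegral.integral_congr; intro v hv
      rw [Set.uIcc_of_le hx] at hv; simp only; rw [abs_of_nonpos (by linarith [hv.1]), neg_sub]
    rw [p1, p2, intervalIntegral.integral_comp_sub_left (fun t => hcd c d t) x, sub_self,
      intervalIntegral.integral_comp_sub_right (fun t => hcd c d t) x, sub_self]
  rw [e1, e2]; ring

/-- (spade) ⇒ `g_y(x) ≥ 0` on the triangle [cite: BuiHall2023, §1 Conjecture 1 — a step of THIS TREE's proof of it (box write-up paper-v3-d979a68f Proposition `11family` (= Prop. 6) — part 1: the fold; `S̃⁰ ≥ 0` from ); the cited paper states the conjecture and the proof is ours] -/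
theorem gInner_nonneg (hsp : Spade c d) {x y : ℝ} (hy : 0 ≤ y) (hyx : y ≤ x) (hx : x ≤ 1) : 0 ≤ gInner c d y x := by
  rw [gInner_formula c d hy hyx hx]
  have := hsp x y hy hyx hx
  linarith

/-- `S̃⁰` is symmetric (Fubini on the rectangle, `q` symmetric) [cite: BuiHall2023, §1 Conjecture 1 — a step of THIS TREE's proof of it (box write-up paper-v3-d979a68f Proposition `11family` (= Prop. 6) — part 1: the fold; `S̃⁰ ≥ 0` from ); the cited paper states the conjecture and the proof is ours] -/
theorem S0_symm (x y : ℝ) : S0 c d x y = S0 c d y x := by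
  unfold S0 gInner
  rw [MeasureTheory.intervalIntegral_intervalIntegral_swap]
  · apply intervalIntegral.integral_congr; intro v _
    apply intervalIntegral.integral_congr; intro u _
    exact qK_symm c d u v
  · have hK : IsCompact (Set.uIcc x 1 ×ˢ Set.uIcc y 1) := isCompact_uIcc.prod isCompact_uIcc
    apply ((qK_continuous c d).continuousOn.integrableOn_compact hK).mono_set
    exact Set.prod_mono Set.uIoc_subset_uIcc Set.uIoc_subset_uIcc

/-- (spade) ⇒ `S̃⁰ ≥ 0` on `[0,1]²` [cite: BuiHall2023, §1 Conjecture 1 — a step of THIS TREE's proof of it (box write-up paper-v3-d979a68f Proposition `11family` (= Prop. 6) — part 1: the fold; `S̃⁰ ≥ 0` from ); the cited paper states the conjecture and the proof is ours] -/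
theorem S0_nonneg (hsp : Spade c d) {x y : ℝ} (hx : x ∈ Icc (0:ℝ) 1) (hy : y ∈ Icc (0:ℝ) 1) : 0 ≤ S0 c d x y := by
  wlog hyx : y ≤ x generalizing x y
  · rw [S0_symm]; exact this hy hx (le_of_not_ge hyx)
  unfold S0
  apply intervalIntegral.integral_nonneg hx.2
  intro u hu
  exact gInner_nonneg c d hsp hy.1 (hyx.trans hu.1) hu.2

/-- (i) ⇒ `g_0(u) = H(1+u) + H(1-u) > 0` for `0 ≤ u < 1`, hence `S̃⁰(x,0) > 0` for `0 ≤ x < 1` [cite: BuiHall2023, §1 Conjecture 1 — a step of THIS TREE's proof of it (box write-up paper-v3-d979a68f Proposition `11family` (= Prop. 6) — part 1: the fold; `S̃⁰ ≥ 0` from ); the cited paper states the conjecture and the proof is ours] -/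
theorem gInner_zero_pos (hi : CondI c d) {u : ℝ} (hu0 : 0 ≤ u) (hu1 : u < 1) : 0 < gInner c d 0 u := by
  rw [gInner_formula c d le_rfl hu0 hu1.le, add_zero, sub_zero]
  have h1 := hi.2 (1 + u) ⟨by linarith, by linarith⟩
  have h2 := hi.1 (1 - u) ⟨by linarith, by linarith⟩
  linarith

/-- Auxiliary lemma `S0_zero_pos` of the Bui–Hall sign-conjecture leg (Proposition `11family` (= Prop. 6) — part 1: the fold, `S̃⁰ ≥ 0` from (spade), `S̃⁰(0,0) > 0` from (i)); statement as displayed, box port verbatim. [cite: BuiHall2023, §1 Conjecture 1 — a step of THIS TREE's proof of it (box write-up paper-v3-d979a68f Proposition `11family` (= Prop. 6) — part 1: the fold; `S̃⁰ ≥ 0` from ); the cited paper states the conjecture and the proof is ours] -/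
theorem S0_zero_pos (hi : CondI c d) {x : ℝ} (hx0 : 0 ≤ x) (hx1 : x < 1) : 0 < S0 c d x 0 := by
  unfold S0
  apply intervalIntegral.intervalIntegral_pos_of_pos_on _ _ hx1
  · exact ((gInner_continuous c d).comp (Continuous.prodMk_right (0:ℝ))).intervalIntegrable _ _
  · intro u hu; exact gInner_zero_pos c d hi (by linarith [hu.1]) hu.2

/-- the fold of `T` for even monomials: `T = 2 ∫_0^1∫_0^1 u^{2a} v^{2b} q(u,v)` [cite: BuiHall2023, §1 Conjecture 1 — a step of THIS TREE's proof of it (box write-up paper-v3-d979a68f Proposition `11family` (= Prop. 6) — part 1: the fold; `S̃⁰ ≥ 0` from ); the cited paper states the conjecture and the proof is ours] -/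
theorem Tint_even_fold (a b : ℕ) :
    Tint c d (2 * a) (2 * b) = 2 * ∫ u in (0:ℝ)..1, ∫ v in (0:ℝ)..1, u ^ (2 * a) * v ^ (2 * b) * qK c d u v := by
  have hcont := hcd_continuous c d
  set f : ℝ → ℝ → ℝ := fun u v => u ^ (2 * a) * v ^ (2 * b) * hcd c d (u + v) with hf
  have hfc : Continuous (Function.uncurry f) := by simp only [hf, Function.uncurry]; fun_prop
  have inner : ∀ u : ℝ, ∫ v in (-1:ℝ)..1, f u v = ∫ v in (0:ℝ)..1, (f u v + f u (-v)) := by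
    intro u
    have hI : ∀ p q : ℝ, IntervalIntegrable (f u) volume p q := fun p q =>
      (hfc.comp (Continuous.prodMk_right u)).intervalIntegrable p q
    rw [← intervalIntegral.integral_add_adjacent_intervals (hI (-1) 0) (hI 0 1)]
    have hneg : ∫ v in (-1:ℝ)..0, f u v = ∫ v in (0:ℝ)..1, f u (-v) := by
      rw [intervalIntegral.integral_comp_neg (fun v => f u v)]; simp
    have hc2 : Continuous fun v => f u (-v) := by exact hfc.comp ((Continuous.prodMk_right u).comp continuous_neg)
    rw [hneg, add_comm, ← intervalIntegral.integral_add (hI 0 1) (hc2.intervalIntegrable 0 1)]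
  set g : ℝ → ℝ := fun u => ∫ v in (0:ℝ)..1, (f u v + f u (-v)) with hg
  have hgc : Continuous g := by
    have : Continuous (Function.uncurry fun (u v : ℝ) => f u v + f u (-v)) := by
      simp only [hf, Function.uncurry]; fun_prop
    exact intervalIntegral.continuous_parametric_intervalIntegral_of_continuous' this 0 1
  have outer : ∫ u in (-1:ℝ)..1, g u = ∫ u in (0:ℝ)..1, (g u + g (-u)) := by
    rw [← intervalIntegral.integral_add_adjacent_intervals (hgc.intervalIntegrable (-1) 0) (hgc.intervalIntegrable 0 1)]
    have hneg : ∫ u in (-1:ℝ)..0, g u = ∫ u in (0:ℝ)..1, g (-u) := by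
      rw [intervalIntegral.integral_comp_neg (fun u => g u)]; simp
    have hc3 : Continuous fun u => g (-u) := by exact hgc.comp continuous_neg
    rw [hneg, add_comm, ← intervalIntegral.integral_add (hgc.intervalIntegrable 0 1) (hc3.intervalIntegrable 0 1)]
  unfold Tint
  simp_rw [show ∀ u v : ℝ, u ^ (2 * a) * v ^ (2 * b) * hcd c d (u + v) = f u v from fun u v => rfl]
  simp_rw [inner]
  change ∫ u in (-1:ℝ)..1, g u = _
  rw [outer, ← intervalIntegral.integral_const_mul]
  apply intervalIntegral.integral_congr; intro u _
  simp only [hg]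
  have hI2 : ∀ w : ℝ, IntervalIntegrable (fun v => f w v + f w (-v)) volume 0 1 := fun w =>
    Continuous.intervalIntegrable (by simp only [hf]; fun_prop) 0 1
  rw [← intervalIntegral.integral_add (hI2 u) (hI2 (-u)), ← intervalIntegral.integral_const_mul]
  apply intervalIntegral.integral_congr; intro v _
  simp only [hf, qK]
  have e1 : hcd c d (u + -v) = hcd c d |u - v| := by
    rw [← sub_eq_add_neg]
    rcases le_total 0 (u - v) with h | h
    · rw [abs_of_nonneg h]
    · rw [abs_of_nonpos h, ← hcd_even c d (u - v)]
  have e2 : hcd c d (-u + v) = hcd c d |u - v| := by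
    rw [show -u + v = -(u - v) by ring, hcd_even]
    rcases le_total 0 (u - v) with h | h
    · rw [abs_of_nonneg h]
    · rw [abs_of_nonpos h, ← hcd_even c d (u - v)]
  have e3 : hcd c d (-u + -v) = hcd c d (u + v) := by rw [show -u + -v = -(u + v) by ring, hcd_even]
  rw [e1, e2, e3, Even.neg_pow (even_two_mul _), Even.neg_pow (even_two_mul _)]
  ring

end eleven1



/-- Discharge BY NAME of the intermediate Prop `ChartIdentity` (box write-up eq. (Tcd)): it is the theorem `chartIdentity_holds` of this module. [cite: BuiHall2023, §1 Conjecture 1 — a step of THIS TREE's proof of it (box write-up paper-v3-d979a68f eq. (Tcd)); the cited paper states the conjecture and the proof is ours] -/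
theorem ChartIdentity_holds : ChartIdentity := chartIdentity_holds

/-- Discharge BY NAME of the intermediate Prop `AllEvenPos` (box write-up Cor. 2 (a)): it is the theorem `allEvenPos_holds` of this module. [cite: BuiHall2023, §1 Conjecture 1 — a step of THIS TREE's proof of it (box write-up paper-v3-d979a68f Cor. 2 (a)); the cited paper states the conjecture and the proof is ours] -/
theorem AllEvenPos_holds : AllEvenPos := allEvenPos_holds

/-- Discharge BY NAME of the intermediate Prop `OddOddCore` (box write-up Prop. 8): it is the theorem `oddOddCore_holds` of this module. [cite: BuiHall2023, §1 Conjecture 1 — a step of THIS TREE's proof of it (box write-up paper-v3-d979a68f Prop. 8); the cited paper states the conjecture and the proof is ours] -/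
theorem OddOddCore_holds : OddOddCore := oddOddCore_holds

/-- Discharge BY NAME of the intermediate Prop `LemmaCConclusions` (box write-up Lemma 7): it is the theorem `lemmaC_conclusions` of this module. [cite: BuiHall2023, §1 Conjecture 1 — a step of THIS TREE's proof of it (box write-up paper-v3-d979a68f Lemma 7); the cited paper states the conjecture and the proof is ours] -/
theorem LemmaCConclusions_holds : LemmaCConclusions := lemmaC_conclusions

end Literature.NumberTheory.LFunctions.BuiHall
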